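import Literature.Geometry.Kaehler.DolbeaultBarFunctionLeibniz
import Literature.Geometry.Kaehler.HolomorphicFunctionsDolbeault
import Literature.Geometry.Kaehler.HolomorphicLineBundleSections
import Literature.Geometry.Kaehler.PluriharmonicConjugate
import HarnessLib

/-!
# The twisted Dolbeault complex of a holomorphic line cocycle and its Čech `H¹` (degree one)

Layer `Literature/Geometry/Kaehler`, companion of `HolomorphicLineBundle` (holomorphic line bundles on
a complex manifold `M` presented by a Čech cocycle `g_ij` on a trivialising cover `U_i`, Voisin I,
§3.3.1 and Thm. 4.49, with the convention `σ_i = g_ij σ_j`, so that coordinates of sections transform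
as `s_j = g_ij s_i`). This file sets up, for such an `L`:

* `L.Refinement A` — an open cover `(V_a)_{a ∈ A}` of `M` refining the trivialising cover through
  `τ : A → ι` (`V_a ⊆ U_{τ a}`), on which `L` is presented by the restricted cocycle
  `t_ab = g_{τa τb}`; the trivialising cover itself is `L.selfRefinement`;
* `R.CompatibleFamily q` — **the `L`-valued `(0,q)`-forms read on the refinement**: families
  `(w_a)_{a ∈ A}`, `w_a ∈ A^{0,q}(V_a)` (`pqFormsOn`), with `w_b = t_ab w_a` on `V_a ∩ V_b`
  (Voisin I, §4.3.1 before Prop. 4.36 / Huybrechts (2005), Def. 2.6.24: `A^{0,q}(E)`); on the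
  trivialising cover these are **`L.PQForms q = A^{0,q}(L)`**;
* `R.famDbar q` / `L.dbar q : A^{0,q}(L) → A^{0,q+1}(L)` — **the operator `∂̄_L`**, computed
  framewise (`localDbar`); well defined because the transition functions are holomorphic,
  `∂̄(t_ab w_a) = t_ab ∂̄w_a` (`dolbeaultBar_fun_smul_apply_of_mdifferentiableOn`; Huybrechts, proof
  of Prop. 2.6.23), with `∂̄_L ∘ ∂̄_L = 0` (`famDbar_famDbar`, `dbar_dbar`);
* `L.H01` — the **twisted Dolbeault group `H^{0,1}(M, L) = ker ∂̄_L / im ∂̄_L`** in bidegree `(0,1)`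
  (Voisin I, Prop. 4.36 / Cor. 4.38: `H^q(X, E) ≅ H^{0,q}_{∂̄}(E)`; here only the group, `q = 1`);
* the **gluing isomorphism** `R.glueEquiv q : R.CompatibleFamily q ≃ₗ[ℂ] L.PQForms q` (`glue`:
  `(glue w)_i = g_{τa, i} w_a` on `V_a ∩ U_i`; `unglue`: `(unglue α)_a = α_{τ a}|_{V_a}`), commuting
  with `∂̄_L` (`dbar_glue`, `famDbar_unglue`);
* the **twisted Čech complex in degrees `0, 1`** of the refinement: holomorphic `0`-cochains `R.C0`
  (`b_a ∈ 𝒪(V_a)`), `1`-cocycles `R.Z1` (`c_ab ∈ 𝒪(V_a ∩ V_b)` in the frame `τ b`, normalised to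
  `0` off `V_a ∩ V_b`, with `c_ad = t_bd c_ab + c_bd` on triple overlaps), the coboundary
  `R.δ0 b = (b_b - t_ab b_a)_{ab}`, `R.B1 = im δ0` and **`R.H1 = Z¹/B¹ = Ȟ¹(𝔙, 𝒪(L))`** (Voisin I,
  §4.3.1, Thm. 4.41; Griffiths–Harris pp. 34–35);
* the **Čech–Dolbeault comparison in degree one** for a FINITE refinement with a smooth partition of
  unity `ρ` subordinate to it (Griffiths–Harris p. 45; Voisin I, proof of Prop. 4.32 / Thm. 4.41 in
  degree `1`): the primitive `h_a = Σ_b ρ_b c_ba` of a cocycle (`prim`, `prim_sub_mul_prim`: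
  `h_b - t_ab h_a = c_ab`), the closed `L`-valued `(0,1)`-form `∂̄ h` (`cocycleFamily`) and the class
  map **`R.toH01 : R.H1 →ₗ[ℂ] L.H01`**, which is INJECTIVE (`toH01_injective`: if `∂̄h = ∂̄_L u` then
  `h_a - u` is holomorphic by Cauchy–Riemann and `c = δ(h - u)`), and SURJECTIVE when every `V_a` is
  `∂̄`-acyclic in bidegrees `(0, ≥ 1)` (`toH01_surjective`: solve `∂̄ u_a = β` on `V_a`, then
  `c_ab = u_b - t_ab u_a` is a holomorphic cocycle of class `[β]`); whence the **Leray isomorphism in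
  degree one** `R.lerayEquivH01 : R.H1 ≃ₗ[ℂ] L.H01` for finite `∂̄`-acyclic refinements, e.g. covers
  by convex chart sets (`isDolbeaultAcyclic_chartSet`).

Everything is proved; the definitions are the carriers listed above. Consumers: the twisted
Cartan–Serre finiteness theorem `dim H¹(M, 𝒪(L)) < ∞` for compact `M` (Schwartz's theorem on the
nested Leray covers of `DolbeaultLerayBanach`, sibling file) and the hyperplane-section exact sequences
of Serre's GAGA n° 16 for line cocycles on a projective manifold
(`Literature.AlgebraicGeometry.HodgeTheory.kodairaSerre_exists_globalSection_algebraicTwist`).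

## References

* C. Voisin, *Hodge Theory and Complex Algebraic Geometry I* (2002), §3.3.1, §4.3.1 (Prop. 4.32,
  Prop. 4.36, Cor. 4.38, Thm. 4.41), Thm. 4.49. [VoisinHodgeI2002]
* D. Huybrechts, *Complex Geometry* (2005), §2.6 (Prop. 2.6.23, Def. 2.6.24, Cor. 2.6.25).
  [HuybrechtsCG2005]
* P. Griffiths, J. Harris, *Principles of Algebraic Geometry* (1978), pp. 34–35, 45–46.
  [GriffithsHarris1978]
-/

noncomputable section

open scoped Manifold ContDiff Topology
open Set Filter Function
open Literature.NumberTheory.Transcendental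

namespace Literature.Geometry.Kaehler

/-! ### Two pointwise lemmas on `0`-forms and types -/

section ZeroForms

variable {E : Type*} [NormedAddCommGroup E] [NormedSpace ℂ E]
  {M : Type*} [TopologicalSpace M] [ChartedSpace E M] {k : ℕ}

/-- The `0`-form of a function vanishes where the function does. [folklore] -/
theorem MForm.ofFun_apply_eq_zero {f : M → ℂ} {x : M} (hx : f x = 0) : MForm.ofFun 𝓘(ℝ, E) f x = 0 := by
  ext v
  rw [MForm.ofFun_apply, hx]
  rfl

/-- `ofFun` of a product is the complex-function multiple. [folklore] -/
theorem MForm.ofFun_mul (t f : M → ℂ) :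
    (MForm.ofFun 𝓘(ℝ, E) fun x ↦ t x * f x) = t • MForm.ofFun 𝓘(ℝ, E) f := by
  funext x; ext v; rfl

/-- A real function times the `0`-form of a complex function. [folklore] -/
theorem MForm.real_smul_ofFun (ρ : M → ℝ) (f : M → ℂ) :
    ρ • MForm.ofFun 𝓘(ℝ, E) f = MForm.ofFun 𝓘(ℝ, E) fun x ↦ (ρ x : ℂ) * f x := by
  funext x; ext v
  simp only [Pi.smul_apply', ContinuousAlternatingMap.smul_apply, MForm.ofFun_apply, Complex.real_smul]

/-- The value of the `0`-form of `f` at `x` on the empty tuple is `f x`. [folklore] -/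
theorem MForm.ofFun_apply_zero_tuple (f : M → ℂ) (x : M) : MForm.ofFun 𝓘(ℝ, E) f x 0 = f x :=
  rfl

/-- **A form which at every point is zero or a multiple of the value of a form of type `(p,q)` is of
type `(p,q)`** (the type condition is pointwise). [cite: VoisinHodgeI2002, §2.3.1] -/
theorem isOfType_of_forall_eq_smul {p q : ℕ} (hk : p + q = k) {α : MForm 𝓘(ℝ, E) M ℂ k}
    (h : ∀ x, α x = 0 ∨ ∃ (c : ℂ) (β : MForm 𝓘(ℝ, E) M ℂ k), IsOfType p q β ∧ α x = c • β x) :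
    IsOfType p q α := by
  refine ⟨hk, fun x θ v ↦ ?_⟩
  rcases h x with h0 | ⟨c, β, hβ, hx⟩
  · simp [h0]
  · rw [hx, ContinuousAlternatingMap.smul_apply, ContinuousAlternatingMap.smul_apply, hβ.2 x θ v,
      smul_eq_mul, smul_eq_mul]
    ring

/-- **A smooth cut-off with `tsupport ⊆ V` times a form on `V ∩ W` is a form on `W`** (same argument as
the tree's `fun_smul_mem_smoothFormsOn_of_tsupport_subset` of `CechDeRham`, repeated to keep the import
closure of this file small). [folklore] -/
theorem real_smul_mem_smoothFormsOn_of_tsupport_subset {V W : Set M} {g : M → ℝ}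
    (hg : ContMDiff 𝓘(ℝ, E) 𝓘(ℝ) ∞ g) (hgV : tsupport g ⊆ V) {α : MForm 𝓘(ℝ, E) M ℂ k}
    (hα : α ∈ smoothFormsOn 𝓘(ℝ, E) ℂ (V ∩ W) k) : g • α ∈ smoothFormsOn 𝓘(ℝ, E) ℂ W k := by
  refine ⟨fun y hy ↦ ?_, fun y hy ↦ ?_⟩
  · by_cases hyV : y ∈ V
    · exact (hα.1 y ⟨hyV, hy⟩).fun_smul (hg y)
    · have h0 : g =ᶠ[𝓝 y] 0 := notMem_tsupport_iff_eventuallyEq.1 fun h ↦ hyV (hgV h)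
      refine MForm.smoothAt_of_eventuallyEq_zero ?_
      filter_upwards [h0] with z hz
      rw [Pi.smul_apply', hz, Pi.zero_apply, zero_smul]
  · rw [Pi.smul_apply', hα.2 y (fun h ↦ hy h.2), smul_zero]

variable [FiniteDimensional ℂ E] [T2Space M] [IsManifold 𝓘(ℂ, E) ω M] [IsManifold 𝓘(ℝ, E) ∞ M]

/-- **Additivity of `∂̄` at a point of an open set on which both forms are smooth** (localise both to
globally smooth forms, `exists_isSmoothForm_eventuallyEq_of_smoothAt`, and use `dolbeaultBar_add`).
[cite: VoisinHodgeI2002, §2.3.3] -/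
theorem dolbeaultBar_add_apply_of_smoothAt {W : Set M} (hW : IsOpen W) {α β : MForm 𝓘(ℝ, E) M ℂ k}
    (hα : ∀ z ∈ W, α.SmoothAt z) (hβ : ∀ z ∈ W, β.SmoothAt z) {x : M} (hx : x ∈ W) :
    dolbeaultBar (α + β) x = dolbeaultBar α x + dolbeaultBar β x := by
  obtain ⟨α', hα's, hα'⟩ := exists_isSmoothForm_eventuallyEq_of_smoothAt hW hα hx
  obtain ⟨β', hβ's, hβ'⟩ := exists_isSmoothForm_eventuallyEq_of_smoothAt hW hβ hx
  have hsum : ∀ᶠ z in 𝓝 x, (α' + β') z = (α + β) z := by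
    filter_upwards [hα', hβ'] with z hz hz'
    rw [Pi.add_apply, Pi.add_apply, hz, hz']
  rw [← dolbeaultBar_congr_of_eventuallyEq hsum,
    dolbeaultBar_add isSmoothForm_typeComponent_holds hα's hβ's, Pi.add_apply,
    dolbeaultBar_congr_of_eventuallyEq hα', dolbeaultBar_congr_of_eventuallyEq hβ']

omit [FiniteDimensional ℂ E] [T2Space M] [IsManifold 𝓘(ℂ, E) ω M] [IsManifold 𝓘(ℝ, E) ∞ M] in
/-- `∂̄(-α) = -∂̄α` pointwise (`ℂ`-linearity of `∂̄`). [folklore] -/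
theorem dolbeaultBar_neg_apply (α : MForm 𝓘(ℝ, E) M ℂ k) (x : M) : dolbeaultBar (-α) x = -dolbeaultBar α x := by
  rw [← neg_one_smul ℂ α, dolbeaultBar_smul_holds, Pi.smul_apply, neg_one_smul]

/-- **Subtractivity of `∂̄` at a point of an open set on which both forms are smooth.**
[cite: VoisinHodgeI2002, §2.3.3] -/
theorem dolbeaultBar_sub_apply_of_smoothAt {W : Set M} (hW : IsOpen W) {α β : MForm 𝓘(ℝ, E) M ℂ k}
    (hα : ∀ z ∈ W, α.SmoothAt z) (hβ : ∀ z ∈ W, β.SmoothAt z) {x : M} (hx : x ∈ W) :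
    dolbeaultBar (α - β) x = dolbeaultBar α x - dolbeaultBar β x := by
  rw [sub_eq_add_neg, dolbeaultBar_add_apply_of_smoothAt hW hα (fun z hz ↦ (hβ z hz).neg) hx,
    dolbeaultBar_neg_apply, ← sub_eq_add_neg]

end ZeroForms

namespace HolomorphicLineBundle

variable {ι : Type*} {E : Type*} [NormedAddCommGroup E] [NormedSpace ℂ E]
  {M : Type*} [TopologicalSpace M] [ChartedSpace E M]

/-! ### Refinements of the trivialising cover -/

variable (L : HolomorphicLineBundle ι E M) in
/-- **A refinement of the trivialising cover of `L`**: an open cover `(V_a)_{a ∈ A}` of `M` with a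
refinement map `τ : A → ι`, `V_a ⊆ U_{τ a}`. On it `L` is presented by the restricted cocycle
`t_ab = g_{τa τb}` (Voisin I, §4.3.1: Čech cohomology is computed on covers on which the sheaf is
acyclic, reached by refinement). [cite: VoisinHodgeI2002, §4.3.1] -/
structure Refinement (A : Type*) where
  /-- the open sets `V_a` -/
  V : A → Set M
  /-- each `V_a` is open -/
  isOpen : ∀ a, IsOpen (V a)
  /-- the `V_a` cover `M` -/
  exists_mem : ∀ x, ∃ a, x ∈ V a
  /-- the refinement map -/
  τ : A → ι
  /-- `V_a ⊆ U_{τ a}` -/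
  subset : ∀ a, V a ⊆ L.baseSet (τ a)

/-- **The trivialising cover as a refinement of itself** (`τ = id`). [folklore] -/
def selfRefinement (L : HolomorphicLineBundle ι E M) : L.Refinement ι where
  V := L.baseSet
  isOpen := L.isOpen_baseSet
  exists_mem := L.exists_mem_baseSet
  τ := id
  subset _ := Subset.rfl

namespace Refinement

variable {L : HolomorphicLineBundle ι E M} {A : Type*} (R : L.Refinement A)

/-- The restricted cocycle `t_ab = g_{τa τb}` presenting `L` on the refinement. [cite: VoisinHodgeI2002, §4.3.1] -/
def t (a b : A) : M → ℂ :=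
  L.coordChange (R.τ a) (R.τ b)

/-- `t_ab` is holomorphic on `V_a ∩ V_b`. [folklore] -/
theorem mdifferentiableOn_t (a b : A) : MDifferentiableOn 𝓘(ℂ, E) 𝓘(ℂ, ℂ) (R.t a b) (R.V a ∩ R.V b) :=
  (L.mdifferentiableOn_coordChange _ _).mono (inter_subset_inter (R.subset a) (R.subset b))

/-- `t_aa = 1` on `V_a`. [folklore] -/
theorem t_self {a : A} {x : M} (hx : x ∈ R.V a) : R.t a a x = 1 :=
  L.coordChange_self _ (R.subset a hx)

/-- The cocycle rule `t_ab t_bd = t_ad` on `V_a ∩ V_b ∩ V_d`. [folklore] -/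
theorem t_mul_t {a b d : A} {x : M} (ha : x ∈ R.V a) (hb : x ∈ R.V b) (hd : x ∈ R.V d) :
    R.t a b x * R.t b d x = R.t a d x :=
  L.coordChange_comp _ _ _ x ⟨⟨R.subset a ha, R.subset b hb⟩, R.subset d hd⟩

/-- `t_ab t_ba = 1` on `V_a ∩ V_b`. [folklore] -/
theorem t_mul_t_symm {a b : A} {x : M} (ha : x ∈ R.V a) (hb : x ∈ R.V b) : R.t a b x * R.t b a x = 1 :=
  L.coordChange_mul_symm _ _ (R.subset a ha) (R.subset b hb)

/-- `t_ab ≠ 0` on `V_a ∩ V_b`. [folklore] -/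
theorem t_ne_zero {a b : A} {x : M} (ha : x ∈ R.V a) (hb : x ∈ R.V b) : R.t a b x ≠ 0 :=
  L.coordChange_ne_zero _ _ x ⟨R.subset a ha, R.subset b hb⟩

/-- `g_{τa, i} g_ij = g_{τa, j}`: changing the target frame. [folklore] -/
theorem coordChange_τ_mul {a : A} {i j : ι} {x : M} (ha : x ∈ R.V a) (hi : x ∈ L.baseSet i)
    (hj : x ∈ L.baseSet j) : L.coordChange (R.τ a) i x * L.coordChange i j x = L.coordChange (R.τ a) j x :=
  L.coordChange_comp _ _ _ x ⟨⟨R.subset a ha, hi⟩, hj⟩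

/-- `t_ab g_{τb, i} = g_{τa, i}`: changing the source frame. [folklore] -/
theorem t_mul_coordChange_τ {a b : A} {i : ι} {x : M} (ha : x ∈ R.V a) (hb : x ∈ R.V b)
    (hi : x ∈ L.baseSet i) : R.t a b x * L.coordChange (R.τ b) i x = L.coordChange (R.τ a) i x :=
  L.coordChange_comp _ _ _ x ⟨⟨R.subset a ha, R.subset b hb⟩, hi⟩

/-- An index `a` with `x ∈ V_a` (a choice). [folklore] -/
def idx (x : M) : A :=
  Classical.choose (R.exists_mem x)

/-- `x ∈ V_{idx x}`. [folklore] -/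
theorem mem_idx (x : M) : x ∈ R.V (R.idx x) :=
  Classical.choose_spec (R.exists_mem x)

/-! ### Compatible families: `L`-valued `(0,q)`-forms read on a refinement -/

/-- **Compatible families of `(0,q)`-forms on the refinement**: `w_a ∈ A^{0,q}(V_a)` (smooth of type
`(0,q)` on `V_a`, zero off `V_a`: `pqFormsOn`) with `w_b = t_ab w_a` on `V_a ∩ V_b` — the
`(0,q)`-forms with values in `L` read in the frames `σ_{τ a}` over the sets of the refinement
(Voisin I, §4.3.1; Huybrechts (2005), Def. 2.6.24: `A^{0,q}(E)`). [cite: VoisinHodgeI2002, §4.3.1] -/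
def CompatibleFamily (q : ℕ) : Submodule ℂ (A → MForm 𝓘(ℝ, E) M ℂ (0 + q)) where
  carrier := {w | (∀ a, w a ∈ pqFormsOn E M (R.V a) 0 q) ∧
    ∀ a b, ∀ x ∈ R.V a ∩ R.V b, w b x = R.t a b x • w a x}
  add_mem' {w w'} hw hw' := ⟨fun a ↦ Submodule.add_mem _ (hw.1 a) (hw'.1 a), fun a b x hx ↦ by
    rw [Pi.add_apply, Pi.add_apply, Pi.add_apply, Pi.add_apply, hw.2 a b x hx, hw'.2 a b x hx, smul_add]⟩
  zero_mem' := ⟨fun a ↦ Submodule.zero_mem _, fun a b x _ ↦ by simp⟩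
  smul_mem' c w hw := ⟨fun a ↦ Submodule.smul_mem _ c (hw.1 a), fun a b x hx ↦ by
    rw [Pi.smul_apply, Pi.smul_apply, Pi.smul_apply, Pi.smul_apply, hw.2 a b x hx, smul_comm]⟩

variable {R} {q : ℕ}

/-- Membership in the compatible families. [folklore] -/
theorem mem_compatibleFamily_iff {w : A → MForm 𝓘(ℝ, E) M ℂ (0 + q)} :
    w ∈ R.CompatibleFamily q ↔ (∀ a, w a ∈ pqFormsOn E M (R.V a) 0 q) ∧
      ∀ a b, ∀ x ∈ R.V a ∩ R.V b, w b x = R.t a b x • w a x :=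
  Iff.rfl

/-- The members of a compatible family are `(0,q)`-forms on the `V_a`. [folklore] -/
theorem CompatibleFamily.mem (w : R.CompatibleFamily q) (a : A) :
    (w : A → MForm 𝓘(ℝ, E) M ℂ (0 + q)) a ∈ pqFormsOn E M (R.V a) 0 q :=
  w.2.1 a

/-- The compatibility `w_b = t_ab w_a`. [folklore] -/
theorem CompatibleFamily.eq_smul (w : R.CompatibleFamily q) {a b : A} {x : M} (ha : x ∈ R.V a)
    (hb : x ∈ R.V b) :
    (w : A → MForm 𝓘(ℝ, E) M ℂ (0 + q)) b x = R.t a b x • (w : A → MForm 𝓘(ℝ, E) M ℂ (0 + q)) a x :=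
  w.2.2 a b x ⟨ha, hb⟩

/-- Members vanish off their sets. [folklore] -/
theorem CompatibleFamily.apply_eq_zero (w : R.CompatibleFamily q) {a : A} {x : M} (hx : x ∉ R.V a) :
    (w : A → MForm 𝓘(ℝ, E) M ℂ (0 + q)) a x = 0 :=
  (CompatibleFamily.mem w a).2.1 x hx

/-- Members are smooth at the points of their sets. [folklore] -/
theorem CompatibleFamily.smoothAt (w : R.CompatibleFamily q) {a : A} {x : M} (hx : x ∈ R.V a) :
    ((w : A → MForm 𝓘(ℝ, E) M ℂ (0 + q)) a).SmoothAt x :=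
  (CompatibleFamily.mem w a).1 x hx

/-- The member `w_a`, as an element of `A^{0,q}(V_a)`. [folklore] -/
def CompatibleFamily.member (w : R.CompatibleFamily q) (a : A) : ↥(pqFormsOn E M (R.V a) 0 q) :=
  ⟨(w : A → MForm 𝓘(ℝ, E) M ℂ (0 + q)) a, CompatibleFamily.mem w a⟩

/-- Underlying form of a member (definitional). [folklore] -/
@[simp] theorem CompatibleFamily.coe_member (w : R.CompatibleFamily q) (a : A) :
    (CompatibleFamily.member w a : MForm 𝓘(ℝ, E) M ℂ (0 + q)) = (w : A → MForm 𝓘(ℝ, E) M ℂ (0 + q)) a :=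
  rfl

/-- Two compatible families with the same members are equal. [folklore] -/
theorem CompatibleFamily.ext {w w' : R.CompatibleFamily q}
    (h : ∀ a, (w : A → MForm 𝓘(ℝ, E) M ℂ (0 + q)) a = (w' : A → MForm 𝓘(ℝ, E) M ℂ (0 + q)) a) : w = w' :=
  Subtype.ext (funext h)

/-! ### The operator `∂̄_L` on compatible families -/

section Dbar

variable [FiniteDimensional ℂ E] [T2Space M] [IsManifold 𝓘(ℂ, E) ω M] [IsManifold 𝓘(ℝ, E) ∞ M]
variable (R q)

/-- **The operator `∂̄_L : A^{0,q} → A^{0,q+1}` on compatible families**, computed framewise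
(`localDbar` on each `V_a`). The result is again compatible: on the open set `V_a ∩ V_b` the form `w_b`
agrees with `t_ab • w_a`, `∂̄` is local, and `∂̄(t_ab • w_a) = t_ab • ∂̄w_a` because `t_ab` is
holomorphic (`dolbeaultBar_fun_smul_apply_of_mdifferentiableOn`). Huybrechts (2005), proof of
Prop. 2.6.23 / Def. 2.6.24; Voisin I, §4.3.1. [cite: HuybrechtsCG2005, Prop. 2.6.23] -/
def famDbar : R.CompatibleFamily q →ₗ[ℂ] R.CompatibleFamily (q + 1) where
  toFun w := ⟨fun a ↦ (localDbar E M (R.isOpen a) 0 q (CompatibleFamily.member w a) : MForm 𝓘(ℝ, E) M ℂ (0 + (q + 1))),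
    fun a ↦ (localDbar E M (R.isOpen a) 0 q (CompatibleFamily.member w a)).2, fun a b x hx ↦ by
      show (localDbar E M (R.isOpen b) 0 q (CompatibleFamily.member w b) : MForm 𝓘(ℝ, E) M ℂ (0 + (q + 1))) x =
        R.t a b x • (localDbar E M (R.isOpen a) 0 q (CompatibleFamily.member w a) : MForm 𝓘(ℝ, E) M ℂ (0 + (q + 1))) x
      rw [localDbar_apply_of_mem _ _ hx.2, localDbar_apply_of_mem _ _ hx.1, CompatibleFamily.coe_member,
        CompatibleFamily.coe_member]
      have hO : IsOpen (R.V a ∩ R.V b) := (R.isOpen a).inter (R.isOpen b)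
      have h1 : ∀ᶠ z in 𝓝 x, (w : A → MForm 𝓘(ℝ, E) M ℂ (0 + q)) b z =
          (R.t a b • (w : A → MForm 𝓘(ℝ, E) M ℂ (0 + q)) a) z := by
        filter_upwards [hO.mem_nhds hx] with z hz
        rw [MForm.fun_smul_complex_apply, CompatibleFamily.eq_smul w hz.1 hz.2]
      rw [dolbeaultBar_congr_of_eventuallyEq h1,
        dolbeaultBar_fun_smul_apply_of_mdifferentiableOn hO (R.mdifferentiableOn_t a b)
          (fun z hz ↦ CompatibleFamily.smoothAt w hz.1) hx]⟩
  map_add' w w' := by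
    refine Subtype.ext (funext fun a ↦ ?_)
    have h : CompatibleFamily.member (w + w') a = CompatibleFamily.member w a + CompatibleFamily.member w' a := rfl
    simp only [h, map_add, Submodule.coe_add, Pi.add_apply]
  map_smul' c w := by
    refine Subtype.ext (funext fun a ↦ ?_)
    have h : CompatibleFamily.member (c • w) a = c • CompatibleFamily.member w a := rfl
    simp only [h, map_smul, Submodule.coe_smul, Pi.smul_apply, RingHom.id_apply]

variable {R q}

/-- The members of `∂̄_L w` are the `∂̄_{V_a} w_a` (definitional). [folklore] -/
theorem member_famDbar (w : R.CompatibleFamily q) (a : A) :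
    CompatibleFamily.member (R.famDbar q w) a = localDbar E M (R.isOpen a) 0 q (CompatibleFamily.member w a) :=
  rfl

/-- The members of `∂̄_L w`, as forms (definitional). [folklore] -/
theorem coe_famDbar_apply (w : R.CompatibleFamily q) (a : A) :
    (R.famDbar q w : A → MForm 𝓘(ℝ, E) M ℂ (0 + (q + 1))) a =
      (localDbar E M (R.isOpen a) 0 q (CompatibleFamily.member w a) : MForm 𝓘(ℝ, E) M ℂ (0 + (q + 1))) :=
  rfl

/-- At a point of `V_a`, the member of `∂̄_L w` is `∂̄ w_a`. [folklore] -/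
theorem famDbar_apply_of_mem (w : R.CompatibleFamily q) {a : A} {x : M} (hx : x ∈ R.V a) :
    (R.famDbar q w : A → MForm 𝓘(ℝ, E) M ℂ (0 + (q + 1))) a x =
      dolbeaultBar ((w : A → MForm 𝓘(ℝ, E) M ℂ (0 + q)) a) x :=
  localDbar_apply_of_mem (R.isOpen a) (CompatibleFamily.member w a) hx

/-- **`∂̄_L ∘ ∂̄_L = 0`** (framewise `∂̄ ∘ ∂̄ = 0`, `localDbar_localDbar`). [cite: HuybrechtsCG2005, Cor. 2.6.25] -/
theorem famDbar_famDbar (w : R.CompatibleFamily q) : R.famDbar (q + 1) (R.famDbar q w) = 0 := by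
  refine CompatibleFamily.ext fun a ↦ ?_
  rw [coe_famDbar_apply, member_famDbar, localDbar_localDbar]
  rfl

end Dbar

end Refinement

/-! ### `A^{0,q}(L)`, `∂̄_L` and `H^{0,1}(M, L)` -/

section PQ

variable (L : HolomorphicLineBundle ι E M) (q : ℕ)

/-- **The `L`-valued `(0,q)`-forms `A^{0,q}(L)`**: families `(α_i)_{i ∈ ι}` with `α_i` a smooth
`(0,q)`-form on the trivialising set `U_i` (zero off `U_i`) — the coordinate of the `L`-valued form in
the frame `σ_i` — subject to the transformation rule `α_j = g_ij α_i` on `U_i ∩ U_j` of coordinates of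
sections of `L`: the compatible families of the trivialising cover (Voisin I, §4.3.1; Huybrechts (2005),
Def. 2.6.24). [cite: VoisinHodgeI2002, §4.3.1] -/
abbrev PQForms : Submodule ℂ (ι → MForm 𝓘(ℝ, E) M ℂ (0 + q)) :=
  L.selfRefinement.CompatibleFamily q

variable {L q}

/-- Membership in `A^{0,q}(L)`. [folklore] -/
theorem mem_PQForms_iff {α : ι → MForm 𝓘(ℝ, E) M ℂ (0 + q)} :
    α ∈ L.PQForms q ↔ (∀ i, α i ∈ pqFormsOn E M (L.baseSet i) 0 q) ∧
      ∀ i j, ∀ x ∈ L.baseSet i ∩ L.baseSet j, α j x = L.coordChange i j x • α i x :=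
  Iff.rfl

variable [FiniteDimensional ℂ E] [T2Space M] [IsManifold 𝓘(ℂ, E) ω M] [IsManifold 𝓘(ℝ, E) ∞ M]
variable (L q)

/-- **The operator `∂̄_L : A^{0,q}(L) → A^{0,q+1}(L)`** (framewise `∂̄`; Huybrechts (2005),
Def. 2.6.24). [cite: HuybrechtsCG2005, Prop. 2.6.23] -/
abbrev dbar : L.PQForms q →ₗ[ℂ] L.PQForms (q + 1) :=
  L.selfRefinement.famDbar q

variable {L q}

/-- `∂̄_L ∘ ∂̄_L = 0`. [cite: HuybrechtsCG2005, Cor. 2.6.25] -/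
theorem dbar_dbar (α : L.PQForms q) : L.dbar (q + 1) (L.dbar q α) = 0 :=
  Refinement.famDbar_famDbar α

variable (L)

/-- The `∂̄_L`-closed `L`-valued `(0,1)`-forms, as a submodule of the families of forms (the image of
`ker ∂̄_L` under the inclusion of `A^{0,1}(L)`). [cite: VoisinHodgeI2002, Prop. 4.36] -/
def closedForms01 : Submodule ℂ (ι → MForm 𝓘(ℝ, E) M ℂ (0 + 1)) :=
  (LinearMap.ker (L.dbar 1)).map (L.PQForms 1).subtype

/-- The `∂̄_L`-exact `L`-valued `(0,1)`-forms (the image of `im ∂̄_L`). [cite: VoisinHodgeI2002, Prop. 4.36] -/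
def exactForms01 : Submodule ℂ (ι → MForm 𝓘(ℝ, E) M ℂ (0 + 1)) :=
  (LinearMap.range (L.dbar 0)).map (L.PQForms 1).subtype

/-- **The twisted Dolbeault group `H^{0,1}(M, L) = ker ∂̄_L / im ∂̄_L`** of the holomorphic line
cocycle `L` (Voisin I, Prop. 4.36 / Cor. 4.38: for a holomorphic bundle `E`,
`H^q(X, E) = H^{0,q}_{∂̄}(E)`; here `q = 1`, and only the group; the exact forms are pulled back into
the closed ones, as for the tree's `dolbeaultCohomology`). [cite: VoisinHodgeI2002, Prop. 4.36] -/
def H01 : Type _ :=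
  ↥L.closedForms01 ⧸ L.exactForms01.comap L.closedForms01.subtype

/-- The additive group structure on `H^{0,1}(M, L)` (the quotient structure). [folklore] -/
instance H01.instAddCommGroup : AddCommGroup L.H01 :=
  Submodule.Quotient.addCommGroup _

/-- The `ℂ`-module structure on `H^{0,1}(M, L)` (the quotient structure). [folklore] -/
instance H01.instModule : Module ℂ L.H01 :=
  Submodule.Quotient.module _

/-- The class map `ker ∂̄_L → H^{0,1}(M, L)`. [folklore] -/
def H01.mk : L.closedForms01 →ₗ[ℂ] L.H01 :=
  Submodule.mkQ _

variable {L}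

/-- Membership in the closed forms: an `L`-valued `(0,1)`-form killed by `∂̄_L`. [folklore] -/
theorem mem_closedForms01_iff {β : ι → MForm 𝓘(ℝ, E) M ℂ (0 + 1)} :
    β ∈ L.closedForms01 ↔ ∃ h : β ∈ L.PQForms 1, L.dbar 1 ⟨β, h⟩ = 0 := by
  constructor
  · rintro ⟨α, hα, rfl⟩
    exact ⟨α.2, LinearMap.mem_ker.1 hα⟩
  · rintro ⟨h, h0⟩
    exact ⟨⟨β, h⟩, LinearMap.mem_ker.2 h0, rfl⟩

/-- Membership in the exact forms: `∂̄_L u` for an `L`-valued smooth function `u`. [folklore] -/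
theorem mem_exactForms01_iff {β : ι → MForm 𝓘(ℝ, E) M ℂ (0 + 1)} :
    β ∈ L.exactForms01 ↔ ∃ u : L.PQForms 0, (L.dbar 0 u : ι → MForm 𝓘(ℝ, E) M ℂ (0 + 1)) = β := by
  constructor
  · rintro ⟨α, ⟨u, rfl⟩, rfl⟩
    exact ⟨u, rfl⟩
  · rintro ⟨u, rfl⟩
    exact ⟨L.dbar 0 u, ⟨u, rfl⟩, rfl⟩

/-- A closed form is an `L`-valued `(0,1)`-form. [folklore] -/
theorem mem_PQForms_of_mem_closedForms01 {β : ι → MForm 𝓘(ℝ, E) M ℂ (0 + 1)} (h : β ∈ L.closedForms01) :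
    β ∈ L.PQForms 1 :=
  (mem_closedForms01_iff.1 h).1

/-- The `L`-valued form underlying a closed form. [folklore] -/
def closedForms01.toPQForms (β : L.closedForms01) : L.PQForms 1 :=
  ⟨β, mem_PQForms_of_mem_closedForms01 β.2⟩

/-- Underlying family (definitional). [folklore] -/
@[simp] theorem closedForms01.coe_toPQForms (β : L.closedForms01) :
    (closedForms01.toPQForms β : ι → MForm 𝓘(ℝ, E) M ℂ (0 + 1)) = β :=
  rfl

/-- Closed forms are killed by `∂̄_L`. [folklore] -/
theorem closedForms01.dbar_toPQForms (β : L.closedForms01) : L.dbar 1 (closedForms01.toPQForms β) = 0 :=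
  (mem_closedForms01_iff.1 β.2).2

/-- `∂̄_L u` is closed. [folklore] -/
theorem dbar_mem_closedForms01 (u : L.PQForms 0) : (L.dbar 0 u : ι → MForm 𝓘(ℝ, E) M ℂ (0 + 1)) ∈ L.closedForms01 :=
  mem_closedForms01_iff.2 ⟨(L.dbar 0 u).2, dbar_dbar u⟩

/-- A `∂̄_L`-closed `L`-valued `(0,1)`-form, as a closed form. [folklore] -/
def closedForms01.ofPQForms (β : L.PQForms 1) (h : L.dbar 1 β = 0) : L.closedForms01 :=
  ⟨β, mem_closedForms01_iff.2 ⟨β.2, h⟩⟩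

/-- Underlying family (definitional). [folklore] -/
@[simp] theorem closedForms01.coe_ofPQForms (β : L.PQForms 1) (h : L.dbar 1 β = 0) :
    (closedForms01.ofPQForms β h : ι → MForm 𝓘(ℝ, E) M ℂ (0 + 1)) = β :=
  rfl

/-- Every class has a closed representative. [folklore] -/
theorem H01.mk_surjective : Surjective (H01.mk L) :=
  Submodule.mkQ_surjective _

/-- A class vanishes iff its representative is `∂̄_L`-exact. [cite: VoisinHodgeI2002, Prop. 4.36] -/
theorem H01.mk_eq_zero_iff (β : L.closedForms01) :
    H01.mk L β = 0 ↔ ∃ u : L.PQForms 0, (L.dbar 0 u : ι → MForm 𝓘(ℝ, E) M ℂ (0 + 1)) = β :=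
  (Submodule.Quotient.mk_eq_zero _).trans mem_exactForms01_iff

/-- Two classes agree iff the representatives differ by a `∂̄_L`-exact form. [cite: VoisinHodgeI2002, Prop. 4.36] -/
theorem H01.mk_eq_mk_iff (β β' : L.closedForms01) :
    H01.mk L β = H01.mk L β' ↔
      ∃ u : L.PQForms 0, (L.dbar 0 u : ι → MForm 𝓘(ℝ, E) M ℂ (0 + 1)) = (β : ι → MForm 𝓘(ℝ, E) M ℂ (0 + 1)) - β' :=
  (Submodule.Quotient.eq _).trans mem_exactForms01_iff

end PQ

/-! ### Gluing: compatible families on a refinement are the `L`-valued forms -/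

namespace Refinement

variable {L : HolomorphicLineBundle ι E M} {A : Type*} (R : L.Refinement A) (q : ℕ)

open Classical in
/-- The glued coordinate: `(glue w)_i x = g_{τa, i}(x) • w_a x` for `x ∈ U_i`, computed with the chosen
`a = idx x` (independent of the choice by compatibility, `glueFun_apply_of_mem`), and `0` off `U_i`.
[cite: VoisinHodgeI2002, §4.3.1] -/
def glueFun (w : A → MForm 𝓘(ℝ, E) M ℂ (0 + q)) (i : ι) : MForm 𝓘(ℝ, E) M ℂ (0 + q) := fun x ↦
  if x ∈ L.baseSet i then L.coordChange (R.τ (R.idx x)) i x • w (R.idx x) x else 0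

variable {R q}

/-- Off `U_i` the glued coordinate vanishes. [folklore] -/
theorem glueFun_apply_of_notMem (w : A → MForm 𝓘(ℝ, E) M ℂ (0 + q)) {i : ι} {x : M}
    (hx : x ∉ L.baseSet i) : R.glueFun q w i x = 0 := by
  simp [glueFun, hx]

/-- **The glued coordinate on `V_a ∩ U_i` is `g_{τa, i} • w_a`** (for a compatible family, any `a`).
[cite: VoisinHodgeI2002, §4.3.1] -/
theorem glueFun_apply_of_mem (w : R.CompatibleFamily q) {a : A} {i : ι} {x : M} (ha : x ∈ R.V a)
    (hi : x ∈ L.baseSet i) :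
    R.glueFun q w i x = L.coordChange (R.τ a) i x • (w : A → MForm 𝓘(ℝ, E) M ℂ (0 + q)) a x := by
  simp only [glueFun, hi, if_true]
  rw [CompatibleFamily.eq_smul w ha (R.mem_idx x), smul_smul, mul_comm, R.t_mul_coordChange_τ ha (R.mem_idx x) hi]

variable [FiniteDimensional ℂ E] [IsManifold 𝓘(ℂ, E) ω M]

omit [FiniteDimensional ℂ E] [IsManifold 𝓘(ℂ, E) ω M] in
/-- Near a point of `V_a ∩ U_i` the glued coordinate is the form `g_{τa, i} • w_a`. [folklore] -/
theorem glueFun_eventuallyEq (w : R.CompatibleFamily q) {a : A} {i : ι} {x : M} (ha : x ∈ R.V a)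
    (hi : x ∈ L.baseSet i) :
    ∀ᶠ z in 𝓝 x, R.glueFun q w i z = (L.coordChange (R.τ a) i • (w : A → MForm 𝓘(ℝ, E) M ℂ (0 + q)) a) z := by
  filter_upwards [((R.isOpen a).inter (L.isOpen_baseSet i)).mem_nhds ⟨ha, hi⟩] with z hz
  rw [glueFun_apply_of_mem w hz.1 hz.2, MForm.fun_smul_complex_apply]

/-- The glued coordinates form an `L`-valued `(0,q)`-form. [cite: VoisinHodgeI2002, §4.3.1] -/
theorem glueFun_mem [IsManifold 𝓘(ℝ, E) ∞ M] (w : R.CompatibleFamily q) : R.glueFun q w ∈ L.PQForms q := by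
  refine ⟨fun i ↦ ⟨fun x hx ↦ ?_, fun x hx ↦ glueFun_apply_of_notMem _ hx, ?_⟩, fun i j x hx ↦ ?_⟩
  · -- smooth at the points of `U_i`: locally `g_{τa, i} • w_a`
    have ha := R.mem_idx x
    refine MForm.SmoothAt.congr_of_eventuallyEq ?_
      ((glueFun_eventuallyEq w ha hx).mono fun z hz ↦ hz.symm)
    exact (CompatibleFamily.smoothAt w ha).fun_smul_complex (contMDiffAt_real_of_mdifferentiableOn_complex
      ((L.mdifferentiableOn_coordChange _ _).mono fun z hz ↦ ⟨R.subset _ hz.1, hz.2⟩)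
      ((R.isOpen _).inter (L.isOpen_baseSet i)) ⟨ha, hx⟩)
  · -- type `(0,q)`, pointwise
    refine isOfType_of_forall_eq_smul rfl fun x ↦ ?_
    by_cases hx : x ∈ L.baseSet i
    · exact Or.inr ⟨L.coordChange (R.τ (R.idx x)) i x, (w : A → MForm 𝓘(ℝ, E) M ℂ (0 + q)) (R.idx x),
        (CompatibleFamily.mem w (R.idx x)).2.2, by simp only [glueFun, hx, if_true]⟩
    · exact Or.inl (glueFun_apply_of_notMem _ hx)
  · -- transformation rule `g_ij`
    have ha := R.mem_idx x
    change R.glueFun q w j x = L.coordChange i j x • R.glueFun q w i x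
    rw [glueFun_apply_of_mem w ha hx.2, glueFun_apply_of_mem w ha hx.1, smul_smul, mul_comm,
      R.coordChange_τ_mul ha hx.1 hx.2]

variable [IsManifold 𝓘(ℝ, E) ∞ M]
variable (R q)

/-- **Gluing**: a compatible family `(w_a)` on the refinement defines the `L`-valued `(0,q)`-form with
coordinates `g_{τa, i} • w_a` on `V_a ∩ U_i`. [cite: VoisinHodgeI2002, §4.3.1] -/
def glue : R.CompatibleFamily q →ₗ[ℂ] L.PQForms q where
  toFun w := ⟨R.glueFun q w, glueFun_mem w⟩
  map_add' w w' := by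
    refine Subtype.ext (funext fun i ↦ funext fun x ↦ ?_)
    change R.glueFun q ((w + w' : R.CompatibleFamily q) : A → MForm 𝓘(ℝ, E) M ℂ (0 + q)) i x =
      R.glueFun q w i x + R.glueFun q w' i x
    by_cases hx : x ∈ L.baseSet i
    · simp only [glueFun, hx, if_true, Submodule.coe_add, Pi.add_apply, smul_add]
    · simp only [glueFun, hx, if_false, add_zero]
  map_smul' c w := by
    refine Subtype.ext (funext fun i ↦ funext fun x ↦ ?_)
    change R.glueFun q ((c • w : R.CompatibleFamily q) : A → MForm 𝓘(ℝ, E) M ℂ (0 + q)) i x = c • R.glueFun q w i x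
    by_cases hx : x ∈ L.baseSet i
    · simp only [glueFun, hx, if_true, Submodule.coe_smul, Pi.smul_apply, smul_comm c]
    · simp only [glueFun, hx, if_false, smul_zero]

/-- **Un-gluing**: the `L`-valued `(0,q)`-form `α` read on the refinement, `(unglue α)_a = α_{τa}|_{V_a}`.
[cite: VoisinHodgeI2002, §4.3.1] -/
def unglue : L.PQForms q →ₗ[ℂ] R.CompatibleFamily q where
  toFun α := ⟨fun a ↦ ((α : ι → MForm 𝓘(ℝ, E) M ℂ (0 + q)) (R.τ a)).restr (R.V a),
    fun a ↦ restr_mem_pqFormsOn (R.isOpen a) (R.subset a) (CompatibleFamily.mem α (R.τ a)), fun a b x hx ↦ by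
      show ((α : ι → MForm 𝓘(ℝ, E) M ℂ (0 + q)) (R.τ b)).restr (R.V b) x =
        R.t a b x • ((α : ι → MForm 𝓘(ℝ, E) M ℂ (0 + q)) (R.τ a)).restr (R.V a) x
      rw [MForm.restr_apply_of_mem _ hx.2, MForm.restr_apply_of_mem _ hx.1]
      exact CompatibleFamily.eq_smul α (R.subset a hx.1) (R.subset b hx.2)⟩
  map_add' α β := by
    refine Subtype.ext (funext fun a ↦ ?_)
    change (((α + β : L.PQForms q) : ι → MForm 𝓘(ℝ, E) M ℂ (0 + q)) (R.τ a)).restr (R.V a) = _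
    rw [Submodule.coe_add, Pi.add_apply, MForm.restr_add]
    rfl
  map_smul' c α := by
    refine Subtype.ext (funext fun a ↦ ?_)
    change (((c • α : L.PQForms q) : ι → MForm 𝓘(ℝ, E) M ℂ (0 + q)) (R.τ a)).restr (R.V a) = _
    rw [Submodule.coe_smul, Pi.smul_apply, MForm.restr_smul_complex]
    rfl

variable {R q}

/-- The coordinates of a glued family (definitional). [folklore] -/
theorem coe_glue_apply (w : R.CompatibleFamily q) (i : ι) :
    (R.glue q w : ι → MForm 𝓘(ℝ, E) M ℂ (0 + q)) i = R.glueFun q w i :=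
  rfl

omit [FiniteDimensional ℂ E] [IsManifold 𝓘(ℂ, E) ω M] [IsManifold 𝓘(ℝ, E) ∞ M] in
/-- The members of an un-glued form (definitional). [folklore] -/
theorem coe_unglue_apply (α : L.PQForms q) (a : A) :
    (R.unglue q α : A → MForm 𝓘(ℝ, E) M ℂ (0 + q)) a =
      ((α : ι → MForm 𝓘(ℝ, E) M ℂ (0 + q)) (R.τ a)).restr (R.V a) :=
  rfl

/-- **`glue ∘ unglue = id`**: `g_{τa, i} α_{τ a} = α_i` on `V_a ∩ U_i`. [cite: VoisinHodgeI2002, §4.3.1] -/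
theorem glue_unglue (α : L.PQForms q) : R.glue q (R.unglue q α) = α := by
  refine CompatibleFamily.ext fun i ↦ funext fun x ↦ ?_
  rw [coe_glue_apply]
  by_cases hx : x ∈ L.baseSet i
  · have ha := R.mem_idx x
    rw [glueFun_apply_of_mem _ ha hx, coe_unglue_apply, MForm.restr_apply_of_mem _ ha]
    exact (CompatibleFamily.eq_smul α (R.subset _ ha) hx).symm
  · rw [glueFun_apply_of_notMem _ hx, CompatibleFamily.apply_eq_zero α hx]

/-- **`unglue ∘ glue = id`**: `g_{τa, τa} w_a = w_a` on `V_a`. [cite: VoisinHodgeI2002, §4.3.1] -/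
theorem unglue_glue (w : R.CompatibleFamily q) : R.unglue q (R.glue q w) = w := by
  refine CompatibleFamily.ext fun a ↦ funext fun x ↦ ?_
  rw [coe_unglue_apply, coe_glue_apply]
  by_cases hx : x ∈ R.V a
  · rw [MForm.restr_apply_of_mem _ hx, glueFun_apply_of_mem w hx (R.subset a hx)]
    change R.t a a x • _ = _
    rw [R.t_self hx, one_smul]
  · rw [MForm.restr_apply_of_notMem _ hx, CompatibleFamily.apply_eq_zero w hx]

variable (R q)

/-- **The gluing isomorphism `A^{0,q}`-compatible families on the refinement `≃ A^{0,q}(L)`.**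
[cite: VoisinHodgeI2002, §4.3.1] -/
def glueEquiv : R.CompatibleFamily q ≃ₗ[ℂ] L.PQForms q :=
  LinearEquiv.ofLinear (R.glue q) (R.unglue q) (LinearMap.ext (glue_unglue (R := R)))
    (LinearMap.ext (unglue_glue (R := R)))

variable {R q}

/-- The gluing isomorphism is `glue` (definitional). [folklore] -/
@[simp] theorem glueEquiv_apply (w : R.CompatibleFamily q) : R.glueEquiv q w = R.glue q w := rfl

/-- Its inverse is `unglue` (definitional). [folklore] -/
@[simp] theorem glueEquiv_symm_apply (α : L.PQForms q) : (R.glueEquiv q).symm α = R.unglue q α := rfl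

variable [T2Space M]

/-- **Gluing commutes with `∂̄_L`**: `∂̄_L (glue w) = glue (∂̄_L w)` (near `x ∈ V_a ∩ U_i` the glued
coordinate is `g_{τa,i} • w_a`, `∂̄` is local and `∂̄(g • w_a) = g • ∂̄ w_a` for the holomorphic `g`).
[cite: HuybrechtsCG2005, Prop. 2.6.23] -/
theorem dbar_glue (w : R.CompatibleFamily q) : L.dbar q (R.glue q w) = R.glue (q + 1) (R.famDbar q w) := by
  refine CompatibleFamily.ext fun i ↦ funext fun x ↦ ?_
  rw [coe_glue_apply]
  by_cases hx : x ∈ L.baseSet i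
  · have ha := R.mem_idx x
    rw [glueFun_apply_of_mem _ ha hx, famDbar_apply_of_mem w ha]
    change (L.selfRefinement.famDbar q (R.glue q w) : ι → MForm 𝓘(ℝ, E) M ℂ (0 + (q + 1))) i x = _
    rw [famDbar_apply_of_mem (R := L.selfRefinement) (R.glue q w) (a := i) hx]
    change dolbeaultBar (R.glueFun q w i) x = _
    have hO : IsOpen (R.V (R.idx x) ∩ L.baseSet i) := (R.isOpen _).inter (L.isOpen_baseSet i)
    rw [dolbeaultBar_congr_of_eventuallyEq (glueFun_eventuallyEq w ha hx),
      dolbeaultBar_fun_smul_apply_of_mdifferentiableOn hO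
        ((L.mdifferentiableOn_coordChange _ _).mono fun z hz ↦ ⟨R.subset _ hz.1, hz.2⟩)
        (fun z hz ↦ CompatibleFamily.smoothAt w hz.1) ⟨ha, hx⟩]
  · rw [glueFun_apply_of_notMem _ hx]
    exact CompatibleFamily.apply_eq_zero (L.dbar q (R.glue q w)) hx

/-- **Un-gluing commutes with `∂̄_L`**: `unglue (∂̄_L α) = ∂̄_L (unglue α)`. [cite: HuybrechtsCG2005, Prop. 2.6.23] -/
theorem famDbar_unglue (α : L.PQForms q) : R.famDbar q (R.unglue q α) = R.unglue (q + 1) (L.dbar q α) := by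
  have h := dbar_glue (R.unglue q α)
  rw [glue_unglue] at h
  rw [h, unglue_glue]

/-! ### The twisted Čech complex of the refinement in degrees `0` and `1` -/

section Cech

omit [FiniteDimensional ℂ E] [IsManifold 𝓘(ℂ, E) ω M] [IsManifold 𝓘(ℝ, E) ∞ M] [T2Space M]

variable (R)

/-- **Holomorphic `0`-cochains** `C⁰(𝔙, 𝒪(L))`: `b_a` holomorphic on `V_a` (the coordinate of a
section of `L` over `V_a` in the frame `σ_{τ a}`), normalised to `0` off `V_a`.
[cite: VoisinHodgeI2002, §4.3.1] -/
def C0 : Submodule ℂ (A → M → ℂ) where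
  carrier := {b | ∀ a, MDifferentiableOn 𝓘(ℂ, E) 𝓘(ℂ, ℂ) (b a) (R.V a) ∧ ∀ x ∉ R.V a, b a x = 0}
  add_mem' hb hb' := fun a ↦ ⟨(hb a).1.add (hb' a).1, fun x hx ↦ by
    rw [Pi.add_apply, Pi.add_apply, (hb a).2 x hx, (hb' a).2 x hx, add_zero]⟩
  zero_mem' := fun a ↦ ⟨mdifferentiableOn_const, fun _ _ ↦ rfl⟩
  smul_mem' c b hb := fun a ↦ ⟨(hb a).1.const_smul c, fun x hx ↦ by
    rw [Pi.smul_apply, Pi.smul_apply, (hb a).2 x hx, smul_zero]⟩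

/-- **Holomorphic `1`-cocycles** `Z¹(𝔙, 𝒪(L))`: `c_ab` holomorphic on `V_a ∩ V_b` (the coordinate,
in the frame `σ_{τ b}`, of a section of `L` over `V_a ∩ V_b`), normalised to `0` off `V_a ∩ V_b`,
with the twisted cocycle condition `c_ad = t_bd c_ab + c_bd` on `V_a ∩ V_b ∩ V_d` (the section
`c_ad` is the sum of the sections `c_ab` and `c_bd`). [cite: VoisinHodgeI2002, §4.3.1] -/
def Z1 : Submodule ℂ (A → A → M → ℂ) where
  carrier := {c | (∀ a b, MDifferentiableOn 𝓘(ℂ, E) 𝓘(ℂ, ℂ) (c a b) (R.V a ∩ R.V b)) ∧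
    (∀ a b, ∀ x ∉ R.V a ∩ R.V b, c a b x = 0) ∧
    ∀ a b d, ∀ x ∈ R.V a ∩ R.V b ∩ R.V d, c a d x = R.t b d x * c a b x + c b d x}
  add_mem' {c c'} hc hc' := ⟨fun a b ↦ (hc.1 a b).add (hc'.1 a b), fun a b x hx ↦ by
      rw [Pi.add_apply, Pi.add_apply, Pi.add_apply, hc.2.1 a b x hx, hc'.2.1 a b x hx, add_zero],
    fun a b d x hx ↦ by
      simp only [Pi.add_apply]
      rw [hc.2.2 a b d x hx, hc'.2.2 a b d x hx]
      ring⟩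
  zero_mem' := ⟨fun _ _ ↦ mdifferentiableOn_const, fun _ _ _ _ ↦ rfl, fun _ _ _ _ _ ↦ by simp⟩
  smul_mem' r c hc := ⟨fun a b ↦ (hc.1 a b).const_smul r, fun a b x hx ↦ by
      rw [Pi.smul_apply, Pi.smul_apply, Pi.smul_apply, hc.2.1 a b x hx, smul_zero],
    fun a b d x hx ↦ by
      simp only [Pi.smul_apply, smul_eq_mul]
      rw [hc.2.2 a b d x hx]
      ring⟩

variable {R}

/-- Cochains are holomorphic on their sets. [folklore] -/
theorem C0.mdifferentiableOn (b : R.C0) (a : A) : MDifferentiableOn 𝓘(ℂ, E) 𝓘(ℂ, ℂ) ((b : A → M → ℂ) a) (R.V a) :=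
  (b.2 a).1

/-- Cochains vanish off their sets. [folklore] -/
theorem C0.apply_eq_zero (b : R.C0) {a : A} {x : M} (hx : x ∉ R.V a) : (b : A → M → ℂ) a x = 0 :=
  (b.2 a).2 x hx

/-- Cocycles are holomorphic on the overlaps. [folklore] -/
theorem Z1.mdifferentiableOn (c : R.Z1) (a b : A) :
    MDifferentiableOn 𝓘(ℂ, E) 𝓘(ℂ, ℂ) ((c : A → A → M → ℂ) a b) (R.V a ∩ R.V b) :=
  c.2.1 a b

/-- Cocycles vanish off the overlaps. [folklore] -/
theorem Z1.apply_eq_zero (c : R.Z1) {a b : A} {x : M} (hx : x ∉ R.V a ∩ R.V b) :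
    (c : A → A → M → ℂ) a b x = 0 :=
  c.2.2.1 a b x hx

/-- The twisted cocycle condition `c_ad = t_bd c_ab + c_bd`. [cite: VoisinHodgeI2002, §4.3.1] -/
theorem Z1.cocycle (c : R.Z1) {a b d : A} {x : M} (ha : x ∈ R.V a) (hb : x ∈ R.V b) (hd : x ∈ R.V d) :
    (c : A → A → M → ℂ) a d x = R.t b d x * (c : A → A → M → ℂ) a b x + (c : A → A → M → ℂ) b d x :=
  c.2.2.2 a b d x ⟨⟨ha, hb⟩, hd⟩

/-- `c_aa = 0` on `V_a`. [folklore] -/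
theorem Z1.apply_self (c : R.Z1) {a : A} {x : M} (ha : x ∈ R.V a) : (c : A → A → M → ℂ) a a x = 0 := by
  have h := Z1.cocycle c ha ha ha
  rw [R.t_self ha, one_mul] at h
  linear_combination -h

/-- `c_ba = -t_ab c_ab` on `V_a ∩ V_b` (skew-symmetry of twisted cocycles). [folklore] -/
theorem Z1.apply_symm (c : R.Z1) {a b : A} {x : M} (ha : x ∈ R.V a) (hb : x ∈ R.V b) :
    (c : A → A → M → ℂ) b a x = -(R.t b a x * (c : A → A → M → ℂ) a b x) := by
  have h := Z1.cocycle c ha hb ha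
  rw [Z1.apply_self c ha] at h
  linear_combination -h

/-- Two cocycles with the same components are equal. [folklore] -/
theorem Z1.ext {c c' : R.Z1} (h : ∀ a b x, x ∈ R.V a ∩ R.V b → (c : A → A → M → ℂ) a b x = (c' : A → A → M → ℂ) a b x) :
    c = c' := by
  refine Subtype.ext (funext fun a ↦ funext fun b ↦ funext fun x ↦ ?_)
  by_cases hx : x ∈ R.V a ∩ R.V b
  · exact h a b x hx
  · rw [Z1.apply_eq_zero c hx, Z1.apply_eq_zero c' hx]

variable (R)

/-- The raw twisted coboundary of a function cochain, `(δ b)_ab = b_b - t_ab b_a` on `V_a ∩ V_b`,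
`0` elsewhere. [cite: VoisinHodgeI2002, §4.3.1] -/
def δ0Fun (b : A → M → ℂ) : A → A → M → ℂ := fun a b' ↦
  (R.V a ∩ R.V b').indicator fun x ↦ b b' x - R.t a b' x * b a x

/-- The raw coboundary on an overlap. [folklore] -/
theorem δ0Fun_apply_of_mem (b : A → M → ℂ) {a d : A} {x : M} (hx : x ∈ R.V a ∩ R.V d) :
    R.δ0Fun b a d x = b d x - R.t a d x * b a x :=
  indicator_of_mem hx _

/-- The raw coboundary off an overlap. [folklore] -/
theorem δ0Fun_apply_of_notMem (b : A → M → ℂ) {a d : A} {x : M} (hx : x ∉ R.V a ∩ R.V d) :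
    R.δ0Fun b a d x = 0 :=
  indicator_of_notMem hx _

/-- The raw coboundary is additive. [folklore] -/
theorem δ0Fun_add (b b' : A → M → ℂ) : R.δ0Fun (b + b') = R.δ0Fun b + R.δ0Fun b' := by
  funext a d x
  by_cases hx : x ∈ R.V a ∩ R.V d
  · simp only [Pi.add_apply, R.δ0Fun_apply_of_mem _ hx]
    ring
  · simp only [Pi.add_apply, R.δ0Fun_apply_of_notMem _ hx, add_zero]

/-- The raw coboundary is homogeneous. [folklore] -/
theorem δ0Fun_smul (r : ℂ) (b : A → M → ℂ) : R.δ0Fun (r • b) = r • R.δ0Fun b := by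
  funext a d x
  by_cases hx : x ∈ R.V a ∩ R.V d
  · simp only [Pi.smul_apply, smul_eq_mul, R.δ0Fun_apply_of_mem _ hx]
    ring
  · simp only [Pi.smul_apply, smul_eq_mul, R.δ0Fun_apply_of_notMem _ hx, mul_zero]

/-- **The twisted cocycle identity of a coboundary** `(δ b)_ad = t_bd (δ b)_ab + (δ b)_bd` (from
`t_ab t_bd = t_ad`). [cite: VoisinHodgeI2002, §4.3.1] -/
theorem δ0Fun_cocycle (b : A → M → ℂ) {a b' d : A} {x : M} (hx : x ∈ R.V a ∩ R.V b' ∩ R.V d) :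
    R.δ0Fun b a d x = R.t b' d x * R.δ0Fun b a b' x + R.δ0Fun b b' d x := by
  rw [R.δ0Fun_apply_of_mem _ (show x ∈ R.V a ∩ R.V d from ⟨hx.1.1, hx.2⟩), R.δ0Fun_apply_of_mem _ hx.1,
    R.δ0Fun_apply_of_mem _ (show x ∈ R.V b' ∩ R.V d from ⟨hx.1.2, hx.2⟩), ← R.t_mul_t hx.1.1 hx.1.2 hx.2]
  ring

/-- **The raw coboundary of a cochain with holomorphic differences is a twisted cocycle.**
[cite: VoisinHodgeI2002, §4.3.1] -/
theorem δ0Fun_mem_Z1 (b : A → M → ℂ)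
    (hb : ∀ a d, MDifferentiableOn 𝓘(ℂ, E) 𝓘(ℂ, ℂ) (fun x ↦ b d x - R.t a d x * b a x) (R.V a ∩ R.V d)) :
    R.δ0Fun b ∈ R.Z1 :=
  ⟨fun a d ↦ (hb a d).congr fun _ hx ↦ R.δ0Fun_apply_of_mem b hx, fun _ _ _ hx ↦ R.δ0Fun_apply_of_notMem b hx,
    fun _ _ _ _ hx ↦ R.δ0Fun_cocycle b hx⟩

/-- The differences `b_b - t_ab b_a` of a holomorphic cochain are holomorphic on the overlaps. [folklore] -/
theorem C0.mdifferentiableOn_sub (b : R.C0) (a d : A) :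
    MDifferentiableOn 𝓘(ℂ, E) 𝓘(ℂ, ℂ) (fun x ↦ (b : A → M → ℂ) d x - R.t a d x * (b : A → M → ℂ) a x)
      (R.V a ∩ R.V d) :=
  ((C0.mdifferentiableOn b d).mono inter_subset_right).sub
    ((R.mdifferentiableOn_t a d).mul ((C0.mdifferentiableOn b a).mono inter_subset_left))

/-- **The twisted Čech coboundary `δ : C⁰ → Z¹`**, `(δ b)_ab = b_b - t_ab b_a` on `V_a ∩ V_b` (the
difference of the two sections, in the frame `σ_{τ b}`), `0` elsewhere. [cite: VoisinHodgeI2002, §4.3.1] -/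
def δ0 : R.C0 →ₗ[ℂ] R.Z1 where
  toFun b := ⟨R.δ0Fun b, R.δ0Fun_mem_Z1 _ (C0.mdifferentiableOn_sub R b)⟩
  map_add' b b' := Subtype.ext (R.δ0Fun_add b b')
  map_smul' r b := Subtype.ext (R.δ0Fun_smul r b)

variable {R}

/-- The coboundary on an overlap. [folklore] -/
theorem δ0_apply_of_mem (b : R.C0) {a d : A} {x : M} (hx : x ∈ R.V a ∩ R.V d) :
    (R.δ0 b : A → A → M → ℂ) a d x = (b : A → M → ℂ) d x - R.t a d x * (b : A → M → ℂ) a x :=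
  R.δ0Fun_apply_of_mem _ hx

/-- The coboundary is the raw coboundary (definitional). [folklore] -/
theorem coe_δ0 (b : R.C0) : (R.δ0 b : A → A → M → ℂ) = R.δ0Fun b :=
  rfl

variable (R)

/-- **The twisted Čech coboundaries `B¹(𝔙, 𝒪(L)) = im δ`.** [cite: VoisinHodgeI2002, §4.3.1] -/
def B1 : Submodule ℂ R.Z1 :=
  LinearMap.range R.δ0

/-- **The twisted Čech cohomology `Ȟ¹(𝔙, 𝒪(L)) = Z¹/B¹`** of the holomorphic line cocycle `L` on the
refinement `𝔙` (Voisin I, §4.3.1 and Thm. 4.41; Griffiths–Harris pp. 34–35).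
[cite: VoisinHodgeI2002, §4.3.1] -/
abbrev H1 : Type _ :=
  R.Z1 ⧸ R.B1

/-- The class map `Z¹ → Ȟ¹`. [folklore] -/
def H1.mk : R.Z1 →ₗ[ℂ] R.H1 :=
  R.B1.mkQ

variable {R}

/-- Every class has a representing cocycle. [folklore] -/
theorem H1.mk_surjective : Surjective (H1.mk R) :=
  Submodule.mkQ_surjective _

/-- A class vanishes iff the cocycle is a coboundary. [cite: VoisinHodgeI2002, §4.3.1] -/
theorem H1.mk_eq_zero_iff (c : R.Z1) : H1.mk R c = 0 ↔ ∃ b : R.C0, R.δ0 b = c := by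
  change (Submodule.Quotient.mk c : R.Z1 ⧸ R.B1) = 0 ↔ _
  rw [Submodule.Quotient.mk_eq_zero, B1, LinearMap.mem_range]

/-- Coboundaries have zero class. [folklore] -/
theorem H1.mk_δ0 (b : R.C0) : H1.mk R (R.δ0 b) = 0 :=
  (H1.mk_eq_zero_iff _).2 ⟨b, rfl⟩

end Cech

/-! ### The Čech–Dolbeault comparison in degree one -/

section Comparison

variable [Fintype A] (ρ : SmoothPartitionOfUnity A 𝓘(ℝ, E) M univ) (hρ : ρ.IsSubordinate R.V)

section Algebra

omit [FiniteDimensional ℂ E] [IsManifold 𝓘(ℂ, E) ω M] [IsManifold 𝓘(ℝ, E) ∞ M] [T2Space M]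

/-- **The primitive `h_a = Σ_b ρ_b c_ba` of a cocycle** (in the frame `σ_{τ a}`, on `V_a`; the terms
vanish off `V_b ∩ V_a`). Griffiths–Harris p. 45; Voisin I, proof of Prop. 4.32.
[cite: GriffithsHarris1978, p. 45] -/
def prim (c : R.Z1) (a : A) : M → ℂ := fun x ↦ ∑ b, (ρ b x : ℂ) * (c : A → A → M → ℂ) b a x

/-- The primitive vanishes off `V_a`. [folklore] -/
theorem prim_apply_of_notMem (c : R.Z1) {a : A} {x : M} (hx : x ∉ R.V a) : prim ρ c a x = 0 :=
  Finset.sum_eq_zero fun b _ ↦ by rw [Z1.apply_eq_zero c fun h ↦ hx h.2, mul_zero]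

omit [Fintype A] in
include hρ in
/-- A cut-off vanishes off its set. [folklore] -/
theorem rho_apply_eq_zero {b : A} {x : M} (hx : x ∉ R.V b) : ρ b x = 0 :=
  notMem_support.1 fun h ↦ hx (hρ b (subset_tsupport _ h))

include hρ in
/-- **`δ h = c`**: `h_b - t_ab h_a = c_ab` on `V_a ∩ V_b` (the cocycle condition `c_db = t_ab c_da + c_ab`
and `Σ_d ρ_d = 1`). Griffiths–Harris p. 45. [cite: GriffithsHarris1978, p. 45] -/
theorem prim_sub_mul_prim (c : R.Z1) {a b : A} {x : M} (ha : x ∈ R.V a) (hb : x ∈ R.V b) :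
    prim ρ c b x - R.t a b x * prim ρ c a x = (c : A → A → M → ℂ) a b x := by
  have hsum : ∑ d, (ρ d x : ℂ) = 1 := by
    have h := ρ.sum_eq_one (mem_univ x)
    rw [finsum_eq_sum_of_fintype] at h
    rw [← Complex.ofReal_sum, h, Complex.ofReal_one]
  have key : ∀ d, (ρ d x : ℂ) * (c : A → A → M → ℂ) d b x - R.t a b x * ((ρ d x : ℂ) * (c : A → A → M → ℂ) d a x) =
      (ρ d x : ℂ) * (c : A → A → M → ℂ) a b x := fun d ↦ by
    by_cases hd : x ∈ R.V d
    · rw [Z1.cocycle c hd ha hb]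
      ring
    · rw [rho_apply_eq_zero ρ hρ hd, Complex.ofReal_zero]
      ring
  simp only [prim, Finset.mul_sum, ← Finset.sum_sub_distrib, key, ← Finset.sum_mul, hsum, one_mul]

/-- The primitive is linear in the cocycle. [folklore] -/
theorem prim_add (c c' : R.Z1) (a : A) : prim ρ (c + c') a = prim ρ c a + prim ρ c' a := by
  funext x
  simp only [prim, Submodule.coe_add, Pi.add_apply, mul_add, Finset.sum_add_distrib]

/-- The primitive is linear in the cocycle. [folklore] -/
theorem prim_smul (r : ℂ) (c : R.Z1) (a : A) : prim ρ (r • c) a = r • prim ρ c a := by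
  funext x
  simp only [prim, Submodule.coe_smul, Pi.smul_apply, smul_eq_mul, Finset.mul_sum]
  exact Finset.sum_congr rfl fun b _ ↦ by ring

omit [Fintype A] in
/-- `(0,0)`-forms on `W` are the forms on `W` (the type condition is empty). [folklore] -/
theorem mem_pqFormsOn_zero_zero_iff {W : Set M} {α : MForm 𝓘(ℝ, E) M ℂ 0} :
    α ∈ pqFormsOn E M W 0 0 ↔ α ∈ smoothFormsOn 𝓘(ℝ, E) ℂ W 0 :=
  ⟨fun h ↦ ⟨h.1, h.2.1⟩, fun h ↦ ⟨h.1, h.2, isOfType_zero_zero α⟩⟩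

end Algebra

omit [Fintype A] [T2Space M] in
/-- The `0`-form of a function holomorphic on an open `W` and zero off `W` is a form on `W`. [folklore] -/
theorem ofFun_mem_smoothFormsOn {W : Set M} (hW : IsOpen W) {f : M → ℂ}
    (hf : MDifferentiableOn 𝓘(ℂ, E) 𝓘(ℂ, ℂ) f W) (h0 : ∀ x ∉ W, f x = 0) :
    MForm.ofFun 𝓘(ℝ, E) f ∈ smoothFormsOn 𝓘(ℝ, E) ℂ W 0 :=
  ⟨fun _ hx ↦ smoothAt_ofFun_of_mdifferentiableOn hW hf hx, fun x hx ↦ MForm.ofFun_apply_eq_zero (h0 x hx)⟩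

omit [T2Space M] in
include hρ in
/-- **The primitive is a smooth function on `V_a`** (as a `0`-form: `Σ_b ρ_b • c_ba` with `c_ba`
holomorphic on `V_b ∩ V_a` and `tsupport ρ_b ⊆ V_b`). [cite: GriffithsHarris1978, p. 45] -/
theorem ofFun_prim_mem (c : R.Z1) (a : A) : MForm.ofFun 𝓘(ℝ, E) (prim ρ c a) ∈ pqFormsOn E M (R.V a) 0 0 := by
  have heq : MForm.ofFun 𝓘(ℝ, E) (prim ρ c a) =
      ∑ b, (ρ b : M → ℝ) • MForm.ofFun 𝓘(ℝ, E) ((c : A → A → M → ℂ) b a) := by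
    funext x
    ext v
    simp only [MForm.ofFun_apply, prim, Finset.sum_apply, ContinuousAlternatingMap.sum_apply,
      Pi.smul_apply', ContinuousAlternatingMap.smul_apply, Complex.real_smul]
  rw [mem_pqFormsOn_zero_zero_iff, heq]
  refine Submodule.sum_mem _ fun b _ ↦ ?_
  exact real_smul_mem_smoothFormsOn_of_tsupport_subset (ρ b).contMDiff (hρ b)
    (ofFun_mem_smoothFormsOn ((R.isOpen b).inter (R.isOpen a)) (Z1.mdifferentiableOn c b a)
      fun x hx ↦ Z1.apply_eq_zero c hx)

/-- The primitive, as an element of `A^{0,0}(V_a)`, linear in the cocycle. [folklore] -/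
def primForm (a : A) : R.Z1 →ₗ[ℂ] ↥(pqFormsOn E M (R.V a) 0 0) where
  toFun c := ⟨MForm.ofFun 𝓘(ℝ, E) (prim ρ c a), ofFun_prim_mem ρ hρ c a⟩
  map_add' c c' := Subtype.ext (by rw [Submodule.coe_add]; exact (congrArg _ (prim_add ρ c c' a)).trans (MForm.ofFun_add _ _))
  map_smul' r c := Subtype.ext (by
    rw [Submodule.coe_smul, RingHom.id_apply]
    change MForm.ofFun 𝓘(ℝ, E) (prim ρ (r • c) a) = r • MForm.ofFun 𝓘(ℝ, E) (prim ρ c a)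
    rw [prim_smul]
    funext x; ext v; rfl)

omit [T2Space M] in
/-- Underlying form of `primForm` (definitional). [folklore] -/
@[simp] theorem coe_primForm (c : R.Z1) (a : A) :
    (primForm ρ hρ a c : MForm 𝓘(ℝ, E) M ℂ 0) = MForm.ofFun 𝓘(ℝ, E) (prim ρ c a) :=
  rfl

include hρ in
/-- **`∂̄ h_b = t_ab • ∂̄ h_a` on `V_a ∩ V_b`**: the `∂̄ h_a` form a compatible family — since
`h_b = t_ab h_a + c_ab` there with `c_ab` holomorphic (`∂̄ c_ab = 0`, Cauchy–Riemann) and `t_ab`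
holomorphic (`∂̄(t h) = t ∂̄h`). Griffiths–Harris p. 45. [cite: GriffithsHarris1978, p. 45] -/
theorem dolbeaultBar_prim_eq_smul (c : R.Z1) {a b : A} {x : M} (ha : x ∈ R.V a) (hb : x ∈ R.V b) :
    dolbeaultBar (MForm.ofFun 𝓘(ℝ, E) (prim ρ c b)) x =
      R.t a b x • dolbeaultBar (MForm.ofFun 𝓘(ℝ, E) (prim ρ c a)) x := by
  have hO : IsOpen (R.V a ∩ R.V b) := (R.isOpen a).inter (R.isOpen b)
  -- near `x`: `h_b = t_ab h_a + c_ab`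
  have h1 : ∀ᶠ z in 𝓝 x, MForm.ofFun 𝓘(ℝ, E) (prim ρ c b) z =
      (R.t a b • MForm.ofFun 𝓘(ℝ, E) (prim ρ c a) + MForm.ofFun 𝓘(ℝ, E) ((c : A → A → M → ℂ) a b)) z := by
    filter_upwards [hO.mem_nhds ⟨ha, hb⟩] with z hz
    ext v
    simp only [Pi.add_apply, ContinuousAlternatingMap.add_apply, MForm.fun_smul_complex_apply,
      ContinuousAlternatingMap.smul_apply, MForm.ofFun_apply, smul_eq_mul]
    linear_combination prim_sub_mul_prim ρ hρ c hz.1 hz.2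
  have hsa : ∀ z ∈ R.V a ∩ R.V b, (R.t a b • MForm.ofFun 𝓘(ℝ, E) (prim ρ c a)).SmoothAt z := fun z hz ↦
    ((ofFun_prim_mem ρ hρ c a).1 z hz.1).fun_smul_complex
      (contMDiffAt_real_of_mdifferentiableOn_complex (R.mdifferentiableOn_t a b) hO hz)
  have hsc : ∀ z ∈ R.V a ∩ R.V b, (MForm.ofFun 𝓘(ℝ, E) ((c : A → A → M → ℂ) a b)).SmoothAt z := fun z hz ↦
    smoothAt_ofFun_of_mdifferentiableOn hO (Z1.mdifferentiableOn c a b) hz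
  rw [dolbeaultBar_congr_of_eventuallyEq h1, dolbeaultBar_add_apply_of_smoothAt hO hsa hsc ⟨ha, hb⟩,
    dolbeaultBar_ofFun_eq_zero_of_mdifferentiableOn hO (Z1.mdifferentiableOn c a b) ⟨ha, hb⟩, add_zero,
    dolbeaultBar_fun_smul_apply_of_mdifferentiableOn hO (R.mdifferentiableOn_t a b)
      (fun z hz ↦ (ofFun_prim_mem ρ hρ c a).1 z hz.1) ⟨ha, hb⟩]

/-- **The `L`-valued `(0,1)`-form `∂̄ h` of a cocycle**, as a compatible family on the refinement
(`(∂̄ h)_a = ∂̄_{V_a} h_a`), linear in the cocycle. Griffiths–Harris p. 45. [cite: GriffithsHarris1978, p. 45] -/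
def cocycleFamily : R.Z1 →ₗ[ℂ] R.CompatibleFamily 1 where
  toFun c := ⟨fun a ↦ (localDbar E M (R.isOpen a) 0 0 (primForm ρ hρ a c) : MForm 𝓘(ℝ, E) M ℂ (0 + (0 + 1))),
    fun a ↦ (localDbar E M (R.isOpen a) 0 0 (primForm ρ hρ a c)).2, fun a b x hx ↦ by
      show (localDbar E M (R.isOpen b) 0 0 (primForm ρ hρ b c) : MForm 𝓘(ℝ, E) M ℂ (0 + (0 + 1))) x =
        R.t a b x • (localDbar E M (R.isOpen a) 0 0 (primForm ρ hρ a c) : MForm 𝓘(ℝ, E) M ℂ (0 + (0 + 1))) x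
      rw [localDbar_apply_of_mem _ _ hx.2, localDbar_apply_of_mem _ _ hx.1, coe_primForm, coe_primForm]
      exact dolbeaultBar_prim_eq_smul ρ hρ c hx.1 hx.2⟩
  map_add' c c' := by
    refine Subtype.ext (funext fun a ↦ ?_)
    simp only [map_add, Submodule.coe_add, Pi.add_apply]
  map_smul' r c := by
    refine Subtype.ext (funext fun a ↦ ?_)
    simp only [map_smul, Submodule.coe_smul, Pi.smul_apply, RingHom.id_apply]

/-- The members of `∂̄ h` (definitional). [folklore] -/
theorem member_cocycleFamily (c : R.Z1) (a : A) :
    CompatibleFamily.member (cocycleFamily ρ hρ c) a = localDbar E M (R.isOpen a) 0 0 (primForm ρ hρ a c) :=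
  rfl

/-- The components of `∂̄ h` (definitional). [folklore] -/
theorem coe_cocycleFamily_apply (c : R.Z1) (a : A) :
    (cocycleFamily ρ hρ c : A → MForm 𝓘(ℝ, E) M ℂ (0 + 1)) a = localDbar E M (R.isOpen a) 0 0 (primForm ρ hρ a c) :=
  rfl

/-- **`∂̄ h` is `∂̄_L`-closed** (`∂̄ ∘ ∂̄ = 0` framewise). [cite: GriffithsHarris1978, p. 45] -/
theorem famDbar_cocycleFamily (c : R.Z1) : R.famDbar 1 (cocycleFamily ρ hρ c) = 0 := by
  refine CompatibleFamily.ext fun a ↦ ?_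
  rw [coe_famDbar_apply, member_cocycleFamily, localDbar_localDbar]
  rfl

/-- The glued closed `L`-valued `(0,1)`-form of a cocycle, linear in the cocycle. [cite: GriffithsHarris1978, p. 45] -/
def cocycleForm : R.Z1 →ₗ[ℂ] L.closedForms01 :=
  LinearMap.codRestrict L.closedForms01 ((L.PQForms 1).subtype.comp ((R.glue 1).comp (cocycleFamily ρ hρ)))
    fun c ↦ mem_closedForms01_iff.2 ⟨(R.glue 1 (cocycleFamily ρ hρ c)).2, by
      show L.dbar 1 (R.glue 1 (cocycleFamily ρ hρ c)) = 0
      rw [dbar_glue, famDbar_cocycleFamily, map_zero]⟩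

/-- Underlying `L`-valued form of `cocycleForm` (definitional). [folklore] -/
theorem coe_cocycleForm (c : R.Z1) :
    (cocycleForm ρ hρ c : ι → MForm 𝓘(ℝ, E) M ℂ (0 + 1)) = R.glue 1 (cocycleFamily ρ hρ c) :=
  rfl

/-- **The class map on cocycles** `Z¹(𝔙, 𝒪(L)) → H^{0,1}(M, L)`, `c ↦ [∂̄ h]`. [cite: GriffithsHarris1978, p. 45] -/
def toH01Z : R.Z1 →ₗ[ℂ] L.H01 :=
  (H01.mk L).comp (cocycleForm ρ hρ)

omit [T2Space M] [Fintype A] in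
/-- The `0`-form of a cochain component is a `(0,0)`-form on `V_a`. [folklore] -/
theorem ofFun_C0_mem (b : R.C0) (a : A) : MForm.ofFun 𝓘(ℝ, E) ((b : A → M → ℂ) a) ∈ pqFormsOn E M (R.V a) 0 0 :=
  mem_pqFormsOn_zero_zero_iff.2 (ofFun_mem_smoothFormsOn (R.isOpen a) (C0.mdifferentiableOn b a) fun _ hx ↦ C0.apply_eq_zero b hx)

/-- **Coboundaries have zero Dolbeault class**: for `c = δ b`, the functions `e_a = h_a - b_a` form a
compatible family of smooth functions (`e_b - t_ab e_a = c_ab - c_ab = 0`), an `L`-valued function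
`e`, and `∂̄ h = ∂̄_L e` since `∂̄ b_a = 0` (`b_a` holomorphic). [cite: GriffithsHarris1978, p. 45] -/
theorem toH01Z_δ0 (b : R.C0) : toH01Z ρ hρ (R.δ0 b) = 0 := by
  set c : R.Z1 := R.δ0 b with hc
  -- the compatible family `e_a = h_a - b_a`
  have he : (fun a ↦ (MForm.ofFun 𝓘(ℝ, E) (prim ρ c a) - MForm.ofFun 𝓘(ℝ, E) ((b : A → M → ℂ) a) :
      MForm 𝓘(ℝ, E) M ℂ (0 + 0))) ∈ R.CompatibleFamily 0 := by
    refine ⟨fun a ↦ Submodule.sub_mem _ (ofFun_prim_mem ρ hρ c a) (ofFun_C0_mem b a), fun a d x hx ↦ ?_⟩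
    ext v
    simp only [Pi.sub_apply, ContinuousAlternatingMap.sub_apply, ContinuousAlternatingMap.smul_apply,
      MForm.ofFun_apply, smul_eq_mul]
    have h1 := prim_sub_mul_prim ρ hρ c hx.1 hx.2
    rw [hc, δ0_apply_of_mem b hx] at h1
    rw [hc]
    linear_combination h1
  set e : R.CompatibleFamily 0 := ⟨_, he⟩ with he_def
  -- `∂̄_L e = ∂̄ h`
  have hde : R.famDbar 0 e = cocycleFamily ρ hρ c := by
    refine CompatibleFamily.ext fun a ↦ ?_
    rw [coe_famDbar_apply]
    change (localDbar E M (R.isOpen a) 0 0 (CompatibleFamily.member e a) : MForm 𝓘(ℝ, E) M ℂ (0 + (0 + 1))) =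
      (localDbar E M (R.isOpen a) 0 0 (primForm ρ hρ a c) : MForm 𝓘(ℝ, E) M ℂ (0 + (0 + 1)))
    have hmem : CompatibleFamily.member e a = primForm ρ hρ a c - ⟨_, ofFun_C0_mem b a⟩ := rfl
    rw [hmem, map_sub, Submodule.coe_sub, sub_eq_self]
    refine funext fun x ↦ ?_
    rw [coe_localDbar, Pi.zero_apply]
    by_cases hx : x ∈ R.V a
    · rw [MForm.restr_apply_of_mem _ hx]
      exact dolbeaultBar_ofFun_eq_zero_of_mdifferentiableOn (R.isOpen a) (C0.mdifferentiableOn b a) hx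
    · rw [MForm.restr_apply_of_notMem _ hx]
  rw [toH01Z, LinearMap.comp_apply, H01.mk_eq_zero_iff]
  exact ⟨R.glue 0 e, by rw [dbar_glue, hde]; rfl⟩

/-- **The comparison map `Ȟ¹(𝔙, 𝒪(L)) → H^{0,1}(M, L)`**, `[c] ↦ [∂̄ h]` with `h_a = Σ_b ρ_b c_ba`
(Griffiths–Harris p. 45: the Dolbeault class of a Čech cocycle; Voisin I, proof of Thm. 4.41 in
degree `1`). Well defined on classes by `toH01Z_δ0`. [cite: GriffithsHarris1978, p. 45] -/
def toH01 : R.H1 →ₗ[ℂ] L.H01 :=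
  R.B1.liftQ (toH01Z ρ hρ) fun c hc ↦ by
    obtain ⟨b, rfl⟩ := LinearMap.mem_range.1 hc
    exact toH01Z_δ0 ρ hρ b

/-- The comparison map on classes of cocycles. [folklore] -/
theorem toH01_mk (c : R.Z1) : toH01 ρ hρ (H1.mk R c) = H01.mk L (cocycleForm ρ hρ c) :=
  rfl

/-- **The comparison map is injective**: if `∂̄ h = ∂̄_L u` for an `L`-valued smooth function `u`, then
`b_a = h_a - u_{τa}` is holomorphic on `V_a` (it is real-`C^∞` with `∂̄ b_a = 0`: Cauchy–Riemann,
`mdifferentiableOn_of_dolbeaultBar_ofFun_eq_zero`) and `δ b = δ h - δ u = c - 0`. Griffiths–Harris p. 45;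
Voisin I, proof of Thm. 4.41. [cite: VoisinHodgeI2002, Thm. 4.41 (proof)] -/
theorem toH01_injective : Injective (toH01 ρ hρ) := by
  refine (injective_iff_map_eq_zero _).2 fun ξ hξ ↦ ?_
  obtain ⟨c, rfl⟩ := H1.mk_surjective ξ
  rw [toH01_mk, H01.mk_eq_zero_iff] at hξ
  obtain ⟨u, hu⟩ := hξ
  have hu' : L.dbar 0 u = R.glue 1 (cocycleFamily ρ hρ c) := Subtype.ext hu
  -- read `u` on the refinement: `∂̄ (unglue u) = ∂̄ h` framewise
  set w : R.CompatibleFamily 0 := R.unglue 0 u with hw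
  have hdw : R.famDbar 0 w = cocycleFamily ρ hρ c := by
    rw [hw, famDbar_unglue, hu', unglue_glue]
  -- the holomorphic `0`-cochain `b_a = h_a - w_a`
  let bf : A → M → ℂ := fun a x ↦ prim ρ c a x - (w : A → MForm 𝓘(ℝ, E) M ℂ (0 + 0)) a x 0
  have hbform : ∀ a, MForm.ofFun 𝓘(ℝ, E) (bf a) =
      MForm.ofFun 𝓘(ℝ, E) (prim ρ c a) - (w : A → MForm 𝓘(ℝ, E) M ℂ (0 + 0)) a := fun a ↦ by
    conv_rhs => rw [← MForm.ofFun_apply_zero_eq ((w : A → MForm 𝓘(ℝ, E) M ℂ (0 + 0)) a)]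
    funext x; ext v; rfl
  have hb : bf ∈ R.C0 := fun a ↦ by
    refine ⟨mdifferentiableOn_of_dolbeaultBar_ofFun_eq_zero (fun x hx ↦ ?_) (fun x hx ↦ ?_), fun x hx ↦ ?_⟩
    · rw [hbform]
      exact ((ofFun_prim_mem ρ hρ c a).1 x hx).sub (CompatibleFamily.smoothAt w hx)
    · -- `∂̄ b_a = ∂̄ h_a - ∂̄ w_a = 0` on `V_a`
      have h1 := congrArg (fun F : R.CompatibleFamily 1 ↦ (F : A → MForm 𝓘(ℝ, E) M ℂ (0 + (0 + 1))) a x) hdw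
      simp only [coe_famDbar_apply, localDbar_apply_of_mem _ _ hx, CompatibleFamily.coe_member,
        coe_cocycleFamily_apply, coe_primForm] at h1
      have hmem : MForm.ofFun 𝓘(ℝ, E) (bf a) ∈ pqFormsOn E M (R.V a) 0 0 := by
        rw [hbform]; exact Submodule.sub_mem _ (ofFun_prim_mem ρ hρ c a) (CompatibleFamily.mem w a)
      have h2 := localDbar_apply_of_mem (R.isOpen a) ⟨_, hmem⟩ hx
      have h3 : localDbar E M (R.isOpen a) 0 0 ⟨_, hmem⟩ =
          localDbar E M (R.isOpen a) 0 0 ⟨_, ofFun_prim_mem ρ hρ c a⟩ - localDbar E M (R.isOpen a) 0 0 (CompatibleFamily.member w a) := by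
        rw [← map_sub]; congr 1; exact Subtype.ext (hbform a)
      rw [← h2, h3, Submodule.coe_sub, Pi.sub_apply, localDbar_apply_of_mem _ _ hx,
        localDbar_apply_of_mem _ _ hx, CompatibleFamily.coe_member, sub_eq_zero]
      exact h1.symm
    · change prim ρ c a x - (w : A → MForm 𝓘(ℝ, E) M ℂ (0 + 0)) a x 0 = 0
      rw [prim_apply_of_notMem ρ c hx, CompatibleFamily.apply_eq_zero w hx]
      simp
  -- `δ b = c`
  have hδ : R.δ0 ⟨bf, hb⟩ = c := by
    refine Z1.ext fun a d x hx ↦ ?_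
    rw [δ0_apply_of_mem _ hx]
    change (prim ρ c d x - (w : A → MForm 𝓘(ℝ, E) M ℂ (0 + 0)) d x 0) -
      R.t a d x * (prim ρ c a x - (w : A → MForm 𝓘(ℝ, E) M ℂ (0 + 0)) a x 0) = _
    have hwad : (w : A → MForm 𝓘(ℝ, E) M ℂ (0 + 0)) d x 0 = R.t a d x * (w : A → MForm 𝓘(ℝ, E) M ℂ (0 + 0)) a x 0 := by
      rw [CompatibleFamily.eq_smul w hx.1 hx.2]; rfl
    linear_combination prim_sub_mul_prim ρ hρ c hx.1 hx.2 - hwad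
  rw [← hδ]
  exact H1.mk_δ0 _

/-- **The comparison map is surjective when the sets of the refinement are `∂̄`-acyclic** in bidegrees
`(0, ≥ 1)` (`IsDolbeaultAcyclic`, e.g. convex chart sets): for a closed `L`-valued `(0,1)`-form `β`,
solve `∂̄ u_a = β_{τ a}` on `V_a`; then `c_ab = u_b - t_ab u_a` is holomorphic on `V_a ∩ V_b`
(Cauchy–Riemann: `∂̄ c_ab = β_b - t_ab β_a = 0`), a cocycle, and `h_a = Σ_d ρ_d c_da = u_a - e_a` with
`e_a = Σ_d ρ_d t_da u_d` an `L`-valued smooth function, so `[∂̄ h] = [β - ∂̄_L e] = [β]`. Griffiths–Harris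
p. 45 / Voisin I, proof of Thm. 4.41 (degree `1`). [cite: VoisinHodgeI2002, Thm. 4.41 (proof)] -/
theorem toH01_surjective (hac : ∀ a, IsDolbeaultAcyclic E M (R.isOpen a) 0) : Surjective (toH01 ρ hρ) := by
  intro ξ
  obtain ⟨β, rfl⟩ := H01.mk_surjective ξ
  -- `β` read on the refinement, and framewise primitives `u_a`
  set F : R.CompatibleFamily 1 := R.unglue 1 (closedForms01.toPQForms β) with hF
  have hF0 : R.famDbar 1 F = 0 := by
    rw [hF, famDbar_unglue, closedForms01.dbar_toPQForms β, map_zero]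
  have hFa : ∀ a, localDbar E M (R.isOpen a) 0 1 (CompatibleFamily.member F a) = 0 := fun a ↦
    Subtype.ext (congrArg (fun G : R.CompatibleFamily 2 ↦ (G : A → MForm 𝓘(ℝ, E) M ℂ (0 + (1 + 1))) a) hF0)
  choose u hu using fun a ↦ hac a 0 (CompatibleFamily.member F a) (hFa a)
  let uf : A → M → ℂ := fun a x ↦ (u a : MForm 𝓘(ℝ, E) M ℂ (0 + 0)) x 0
  have huform : ∀ a, MForm.ofFun 𝓘(ℝ, E) (uf a) = (u a : MForm 𝓘(ℝ, E) M ℂ (0 + 0)) := fun a ↦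
    MForm.ofFun_apply_zero_eq _
  have hu0 : ∀ a, ∀ x ∉ R.V a, uf a x = 0 := fun a x hx ↦ by
    change (u a : MForm 𝓘(ℝ, E) M ℂ (0 + 0)) x 0 = 0
    rw [(u a).2.2.1 x hx]; rfl
  have hdu : ∀ a, ∀ x ∈ R.V a, dolbeaultBar (u a : MForm 𝓘(ℝ, E) M ℂ (0 + 0)) x =
      (F : A → MForm 𝓘(ℝ, E) M ℂ (0 + 1)) a x := fun a x hx ↦ by
    rw [← localDbar_apply_of_mem (R.isOpen a) (u a) hx, hu a]; rfl
  -- the cocycle `c_ab = u_b - t_ab u_a`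
  let cf : A → A → M → ℂ := R.δ0Fun uf
  have hchol : ∀ a b, MDifferentiableOn 𝓘(ℂ, E) 𝓘(ℂ, ℂ) (fun x ↦ uf b x - R.t a b x * uf a x) (R.V a ∩ R.V b) := by
    intro a b
    have hO : IsOpen (R.V a ∩ R.V b) := (R.isOpen a).inter (R.isOpen b)
    have hsb : ∀ z ∈ R.V a ∩ R.V b, (MForm.ofFun 𝓘(ℝ, E) (uf b)).SmoothAt z := fun z hz ↦ by
      rw [huform]; exact (u b).2.1 z hz.2
    have hsa : ∀ z ∈ R.V a ∩ R.V b, (R.t a b • MForm.ofFun 𝓘(ℝ, E) (uf a)).SmoothAt z := fun z hz ↦ by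
      rw [huform]
      exact ((u a).2.1 z hz.1).fun_smul_complex
        (contMDiffAt_real_of_mdifferentiableOn_complex (R.mdifferentiableOn_t a b) hO hz)
    refine mdifferentiableOn_of_dolbeaultBar_ofFun_eq_zero (fun x hx ↦ ?_) (fun x hx ↦ ?_)
    · have h : (MForm.ofFun 𝓘(ℝ, E) fun x ↦ uf b x - R.t a b x * uf a x) =
          MForm.ofFun 𝓘(ℝ, E) (uf b) - R.t a b • MForm.ofFun 𝓘(ℝ, E) (uf a) := by
        funext z; ext v; rfl
      rw [h]; exact (hsb x hx).sub (hsa x hx)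
    · have h : (MForm.ofFun 𝓘(ℝ, E) fun x ↦ uf b x - R.t a b x * uf a x) =
          MForm.ofFun 𝓘(ℝ, E) (uf b) - R.t a b • MForm.ofFun 𝓘(ℝ, E) (uf a) := by
        funext z; ext v; rfl
      rw [h, dolbeaultBar_sub_apply_of_smoothAt hO hsb hsa hx, huform,
        dolbeaultBar_fun_smul_apply_of_mdifferentiableOn hO (R.mdifferentiableOn_t a b)
          (fun z hz ↦ by rw [huform]; exact (u a).2.1 z hz.1) hx, huform, hdu b x hx.2, hdu a x hx.1,
        CompatibleFamily.eq_smul F hx.1 hx.2, sub_self]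
  have hc : cf ∈ R.Z1 := R.δ0Fun_mem_Z1 uf hchol
  set c : R.Z1 := ⟨cf, hc⟩ with hc_def
  refine ⟨H1.mk R c, ?_⟩
  rw [toH01_mk, H01.mk_eq_mk_iff]
  -- the `L`-valued smooth function `e_a = Σ_d ρ_d t_da u_d`
  let ef : A → MForm 𝓘(ℝ, E) M ℂ (0 + 0) := fun a ↦
    ∑ d, (ρ d : M → ℝ) • (R.t d a • ((u d : MForm 𝓘(ℝ, E) M ℂ (0 + 0)).restr (R.V d ∩ R.V a)))
  have hef_apply : ∀ a x, ef a x 0 = ∑ d, (ρ d x : ℂ) * (R.t d a x * ((u d : MForm 𝓘(ℝ, E) M ℂ (0 + 0)).restr (R.V d ∩ R.V a) x 0)) := by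
    intro a x
    simp only [ef, Finset.sum_apply, ContinuousAlternatingMap.sum_apply, Pi.smul_apply',
      ContinuousAlternatingMap.smul_apply, Complex.real_smul, smul_eq_mul]
  have he : ef ∈ R.CompatibleFamily 0 := by
    refine ⟨fun a ↦ ?_, fun a b x hx ↦ ?_⟩
    · rw [mem_pqFormsOn_zero_zero_iff]
      refine Submodule.sum_mem _ fun d _ ↦ ?_
      have hO : IsOpen (R.V d ∩ R.V a) := (R.isOpen d).inter (R.isOpen a)
      exact real_smul_mem_smoothFormsOn_of_tsupport_subset (ρ d).contMDiff (hρ d)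
        (fun_smul_mem_smoothFormsOn_of_mdifferentiableOn hO (R.mdifferentiableOn_t d a)
          (mem_smoothFormsOn_of_mem_pqFormsOn (restr_mem_pqFormsOn hO inter_subset_left (u d).2)))
    · -- `e_b = t_ab e_a` from `t_da t_ab = t_db`
      rw [← MForm.ofFun_apply_zero_eq (ef b), ← MForm.ofFun_apply_zero_eq (ef a)]
      ext v
      simp only [MForm.ofFun_apply, ContinuousAlternatingMap.smul_apply, smul_eq_mul, hef_apply, Finset.mul_sum]
      refine Finset.sum_congr rfl fun d _ ↦ ?_
      by_cases hd : x ∈ R.V d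
      · rw [MForm.restr_apply_of_mem _ (show x ∈ R.V d ∩ R.V b from ⟨hd, hx.2⟩),
          MForm.restr_apply_of_mem _ (show x ∈ R.V d ∩ R.V a from ⟨hd, hx.1⟩), ← R.t_mul_t hd hx.1 hx.2]
        ring
      · rw [rho_apply_eq_zero ρ hρ hd, Complex.ofReal_zero]
        ring
  set e : R.CompatibleFamily 0 := ⟨ef, he⟩ with he_def
  -- `h_a = u_a - e_a` on `V_a`, as `(0,0)`-forms
  have hprim : ∀ a, primForm ρ hρ a c = u a - CompatibleFamily.member e a := fun a ↦ by
    apply Subtype.ext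
    rw [Submodule.coe_sub, coe_primForm, CompatibleFamily.coe_member, ← huform]
    change MForm.ofFun 𝓘(ℝ, E) (prim ρ c a) = MForm.ofFun 𝓘(ℝ, E) (uf a) - ef a
    rw [← MForm.ofFun_apply_zero_eq (ef a)]
    funext x; ext v
    simp only [MForm.ofFun_apply, Pi.sub_apply, ContinuousAlternatingMap.sub_apply, prim, hef_apply]
    by_cases hxa : x ∈ R.V a
    · have hsum : ∑ d, (ρ d x : ℂ) = 1 := by
        have h := ρ.sum_eq_one (mem_univ x)
        rw [finsum_eq_sum_of_fintype] at h
        rw [← Complex.ofReal_sum, h, Complex.ofReal_one]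
      have : uf a x = ∑ d, (ρ d x : ℂ) * uf a x := by rw [← Finset.sum_mul, hsum, one_mul]
      change ∑ d, (ρ d x : ℂ) * cf d a x = uf a x - _
      rw [this, ← Finset.sum_sub_distrib]
      refine Finset.sum_congr rfl fun d _ ↦ ?_
      by_cases hd : x ∈ R.V d
      · simp only [cf, R.δ0Fun_apply_of_mem uf (show x ∈ R.V d ∩ R.V a from ⟨hd, hxa⟩),
          MForm.restr_apply_of_mem _ (show x ∈ R.V d ∩ R.V a from ⟨hd, hxa⟩)]
        ring
      · rw [rho_apply_eq_zero ρ hρ hd, Complex.ofReal_zero]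
        ring
    · change ∑ d, (ρ d x : ℂ) * cf d a x = uf a x - _
      have h0 : ∀ d, cf d a x = 0 := fun d ↦ R.δ0Fun_apply_of_notMem uf fun h ↦ hxa h.2
      simp only [h0, mul_zero, Finset.sum_const_zero, hu0 a x hxa]
      rw [eq_comm, sub_eq_zero, eq_comm]
      refine Finset.sum_eq_zero fun d _ ↦ ?_
      rw [MForm.restr_apply_of_notMem _ (fun h ↦ hxa h.2)]
      simp
  -- hence `∂̄ h = F - ∂̄_L e` and `[∂̄ h] = [β]`
  have hfam : cocycleFamily ρ hρ c = F - R.famDbar 0 e := by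
    refine CompatibleFamily.ext fun a ↦ ?_
    rw [Submodule.coe_sub, Pi.sub_apply, coe_famDbar_apply]
    change (localDbar E M (R.isOpen a) 0 0 (primForm ρ hρ a c) : MForm 𝓘(ℝ, E) M ℂ (0 + (0 + 1))) = _
    rw [hprim, map_sub, Submodule.coe_sub, hu]
    rfl
  refine ⟨-R.glue 0 e, ?_⟩
  have hglue : R.glue 1 (cocycleFamily ρ hρ c) = closedForms01.toPQForms β - L.dbar 0 (R.glue 0 e) := by
    rw [hfam, map_sub, hF, glue_unglue, dbar_glue]
  rw [map_neg, Submodule.coe_neg, coe_cocycleForm, hglue, Submodule.coe_sub, closedForms01.coe_toPQForms]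
  abel

/-- **The Leray isomorphism in degree one** `Ȟ¹(𝔙, 𝒪(L)) ≃ H^{0,1}(M, L)` for a finite refinement by
`∂̄`-acyclic open sets (Voisin I, Thm. 4.41 / Cor. 4.38 for the line bundle `L`, degree `1`;
Griffiths–Harris pp. 45–46). [cite: VoisinHodgeI2002, Thm. 4.41] -/
def lerayEquivH01 (hac : ∀ a, IsDolbeaultAcyclic E M (R.isOpen a) 0) : R.H1 ≃ₗ[ℂ] L.H01 :=
  LinearEquiv.ofBijective (toH01 ρ hρ) ⟨toH01_injective ρ hρ, toH01_surjective ρ hρ hac⟩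

/-- The Leray isomorphism is the comparison map (definitional). [folklore] -/
@[simp] theorem lerayEquivH01_apply (hac : ∀ a, IsDolbeaultAcyclic E M (R.isOpen a) 0) (ξ : R.H1) :
    lerayEquivH01 ρ hρ hac ξ = toH01 ρ hρ ξ :=
  rfl

end Comparison

/-! ### Existence of the comparison data on a Hausdorff σ-compact manifold -/

section Exists

variable [SigmaCompactSpace M]

omit [IsManifold 𝓘(ℂ, E) ω M] in
/-- **A smooth partition of unity subordinate to the refinement exists** (Mathlib). [folklore] -/
theorem exists_isSubordinate : ∃ ρ : SmoothPartitionOfUnity A 𝓘(ℝ, E) M univ, ρ.IsSubordinate R.V :=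
  SmoothPartitionOfUnity.exists_isSubordinate 𝓘(ℝ, E) isClosed_univ R.V R.isOpen
    fun x _ ↦ mem_iUnion.2 (R.exists_mem x)

/-- **`Ȟ¹(𝔙, 𝒪(L)) ≃ H^{0,1}(M, L)` for a finite `∂̄`-acyclic refinement of a Hausdorff σ-compact
complex manifold** (some comparison map; Voisin I, Thm. 4.41 in degree `1`). [cite: VoisinHodgeI2002, Thm. 4.41] -/
theorem nonempty_H1_equiv_H01 [Fintype A] (hac : ∀ a, IsDolbeaultAcyclic E M (R.isOpen a) 0) : Nonempty (R.H1 ≃ₗ[ℂ] L.H01) := by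
  obtain ⟨ρ, hρ⟩ := R.exists_isSubordinate
  exact ⟨lerayEquivH01 ρ hρ hac⟩

end Exists

end Refinement

end HolomorphicLineBundle

end Literature.Geometry.Kaehler

end
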